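import Literature.Computability.Cryptography.PrincipalCycleWalkFP
import Literature.Computability.Cryptography.HallgrenShiftParams
import Literature.Computability.Cryptography.ShiftSamplingReadout
import Literature.Computability.Cryptography.HallgrenPell
import Literature.Computability.QuantumComplexity.CWrapAssembly
import Literature.Computability.Cryptography.HallgrenCandidateCheck
import Literature.Computability.Cryptography.ConvergentNumeratorsFP
import Literature.Computability.Cryptography.PeriodFindingTwoSamples
import Literature.Computability.Cryptography.HallgrenCombCorrMass
import Literature.Computability.Cryptography.HallgrenBlurredTable
import Literature.Computability.Cryptography.ShorOrdPost
import Literature.NumberTheory.QuadraticFields.RealQuadraticRegulator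
import HarnessLib

/-!
# Hallgren's algorithm assembled: the regulator of `ℚ(√d)` in quantum polynomial time (`Hallgren2007_regulator_qsolvable_delim_holds`)

Topic `Computability/Cryptography`; discharges the named fact `Hallgren2007_regulator_qsolvable_delim`
of `HallgrenPell.lean` (and, through `Hallgren2007_regulator_qsolvable_of_delim` of
`HallgrenPellPlainProofs.lean`, `Hallgren2007_regulator_qsolvable` — see `HallgrenPellHolds.lean`) (Hallgren 2002/2007 via Jozsa 2003,
Thm. 7: the integer part of the regulator of a real quadratic field in `BQP`, no Riemann hypothesis)
by assembling the tree's bricks along the printed proof: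

* the INSTANCE (`§6–§9`): the principal cycle of `D = fundDiscr d` with fixed-point evaluators is a
  `GiantStepCycle` (`PrincipalCycleWalk.principalGSC`) whose walk table is polynomial time
  (`PrincipalCycleWalkFP.principalTableC`); the input `bin d` fixes `D`, all other parameters are
  functions of the input length (`HallgrenParams.lean`);
* the QUANTUM CORE (`§10`, first half): the shift experiment on that table
  (`ShiftSamplingBlock/Family/Uniform.lean`: an oracle-free, polynomial-time uniform Clifford+`T`
  family whose read-out law is the product over the units of Kitaev's per-unit laws,
  `kernelProb_family`);
* the ANALYSIS (`§10`, proof of Thm. 6): the table is a blurred gap table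
  (`HallgrenBlurredTable.blurred`), so every small harmonic of `Q/S` is a heavy character
  (`HallgrenCombCorrMass.corrMass_harmonic_ge`), each read off a unit with its weight
  (`PeriodFindingTwoSamples.prob_cEst_ge`), two units give a coprime pair of harmonics with constant
  probability (`prob_twoSamples_ge`), and `2^43` disjoint pairs succeed with probability `≥ 2/3`
  (`PeriodFindingIndependence.prob_exists_pair_ge`);
* the CLASSICAL HALF (`§10`, end): the character of each unit (`CEstFP.lean`,
  `ShiftSamplingReadout.codeFP_charOf`), the convergent numerators of `c/d`
  (`ConvergentNumeratorsFP.lean`), the candidates `⌊p q/c⌉`, the walk-based test of a candidate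
  (`HallgrenCandidateCheck.passes_sound/complete`, run by `finalC`/`babyStepC`), the least accepted
  candidate and the rounding `⌊m/N⌉ ∈ {⌊R⌋, ⌈R⌉}` — a polynomial-time post-processor `g`, so that
  `isQSolvable_classicalWrap_holds` (Bernstein–Vazirani 1997, §8) turns the family into a solver of
  the self-delimiting relation; the prefix form follows by `Hallgren2007_regulator_qsolvable_of_delim`
  (`HallgrenPellPlainProofs.lean`).

Theorem-and-definition file; the only named fact touched is the one it DISCHARGES.

## References

* R. Jozsa, *Notes on Hallgren's efficient quantum algorithm for solving Pell's equation*,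
  arXiv:quant-ph/0302134 (2003), §9 Thm. 5, §10 Prop. 36, Thm. 6, Lemmas 2–3, Thm. 7. [Jozsa2003]
* S. Hallgren, *Polynomial-time quantum algorithms for Pell's equation and the principal ideal
  problem*, J. ACM 54 (2007), Art. 4. [Hallgren2007]
* A. Yu. Kitaev, arXiv:quant-ph/9511026 (1995), §3–§4. [Kitaev1995]
* E. Bernstein, U. Vazirani, SIAM J. Comput. 26 (1997), §8. [BernsteinVazirani1997]
-/

noncomputable section

namespace Literature.Computability.Cryptography

namespace HallgrenQuantum

open _root_.Computability Complexity Complexity.CodeFP QuantumComplexity ShiftSampling Kitaev1995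
  PeriodFinding Finset WalkData Polynomial
open Literature.NumberTheory.QuadraticFields Literature.NumberTheory.QuadraticFields.QuadIrr
open Literature.NumberTheory.QuadraticFields.Quadratic (fundDiscr)
open Literature.Algebra.EuclideanLattices (encodeRat)
open Hallgren2007 OFPostCF

/-! ### The instance read off the input -/

/-- The input number `d = ⟦x⟧`. [folklore] -/
def dOf (x : List Bool) : ℕ := decodeNat x

/-- The discriminant `D = fundDiscr d ∈ {d, 4d}` as a natural number. [cite: Jozsa2003, §3 (Thm 2: the discriminant of ℚ(√d))] -/
def DOf (x : List Bool) : ℕ := (fundDiscr (dOf x)).toNat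

/-- `D` in natural-number arithmetic. [folklore] -/
theorem DOf_eq (x : List Bool) : DOf x = if dOf x % 4 = 1 then dOf x else 4 * dOf x := by
  unfold DOf fundDiscr
  split_ifs with h
  · simp
  · rw [show (4 : ℤ) * (dOf x : ℤ) = ((4 * dOf x : ℕ) : ℤ) by push_cast; ring, Int.toNat_natCast]

/-- The grid size `N = 2^{a(n)}`. [cite: Jozsa2003, §10 Prop. 36] -/
def Ngrid (n : ℕ) : ℕ := 2 ^ aN n

/-- `N > 0`. [folklore] -/
theorem Ngrid_pos (n : ℕ) : 0 < Ngrid n := Nat.two_pow_pos _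

/-- The walk data of input `x`: the principal cycle of `D` at precision `prec(|x|)`. [cite: Jozsa2003, §9 Thm. 5] -/
def Wx (x : List Bool) : WalkData (QuadIrr (DOf x)) := principalWalk (DOf x) (precP x.length)

/-- **The table of input `x`**: the code `⟨⟨dp P, dp Q⟩, dp offset⟩` of the walk's table value at
grid point `v` (`InfrastructureNavigation.WalkData.table` at `N`, `s₀`, `T`, `2M` of `|x|`).
[cite: Jozsa2003, §10 (h̃_N)] -/
def tab (x : List Bool) (v : ℕ) : List Bool :=
  pairE (pairE intE intE) intE (Prod.map toZ id
    ((Wx x).table (Ngrid x.length) (s0 x.length) (Tdbl x.length) (2 * Mfin x.length) (v : ℤ)))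

/-- `toZ` is injective. [folklore] -/
theorem toZ_injective {D : ℕ} : Function.Injective (toZ : QuadIrr D → ZZ) := by
  rintro ⟨p, q⟩ ⟨p', q'⟩ h
  have h1 : p = p' := congrArg Prod.fst h
  have h2 : q = q' := congrArg Prod.snd h
  subst h1; subst h2; rfl

/-- The table's code is injective in the table value. [folklore] -/
theorem tab_eq_tab_iff (x : List Bool) (v v' : ℕ) : tab x v = tab x v' ↔
    (Wx x).table (Ngrid x.length) (s0 x.length) (Tdbl x.length) (2 * Mfin x.length) (v : ℤ) =
      (Wx x).table (Ngrid x.length) (s0 x.length) (Tdbl x.length) (2 * Mfin x.length) (v' : ℤ) := by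
  unfold tab
  constructor
  · intro h
    have h1 := (pairE_injective (pairE_injective intE_injective intE_injective) intE_injective) h
    exact (Function.Injective.prodMap toZ_injective Function.injective_id) h1
  · intro h; rw [h]

/-! ### The family -/

/-- The block function of the family is polynomial time (given the table program). [cite: Jozsa2003, §10 Thm. 6 (a)] -/
theorem blockFn_mem_FP (htab : CodeFP (pairE strE natE) strE fun p => tab p.1 p.2) : hallgrenSS.blockFn tab ∈ FP :=
  hallgrenSS.blockFn_mem_FP nU_un L_un Lv_un B_un htab

/-- **The quantum core of Hallgren's algorithm** (for the walk table of the input). [cite: Jozsa2003, §10 (proof of Thm. 6)] -/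
def fam (htab : CodeFP (pairE strE natE) strE fun p => tab p.1 p.2) : QCircuitFamily cliffordT :=
  hallgrenSS.family (blockFn_mem_FP htab)

/-! ### The classical post-processing (specification) -/

/-- `⌊a / c⌉` for naturals (`⌊(2a + c)/2c⌋`). [folklore] -/
def rdiv (a c : ℕ) : ℕ := (2 * a + c) / (2 * c)

/-- `rdiv a c = round (a / c)` for `c > 0`. [folklore] -/
theorem rdiv_eq_round {a c : ℕ} (hc : 0 < c) : (rdiv a c : ℤ) = round ((a : ℝ) / c) := by
  rw [round_eq, rdiv]
  have hc' : (0 : ℝ) < c := by exact_mod_cast hc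
  have h : (a : ℝ) / c + 1 / 2 = ((2 * a + c : ℕ) : ℝ) / ((2 * c : ℕ) : ℝ) := by
    push_cast; field_simp
  rw [h, ← Int.natCast_floor_eq_floor (by positivity), Nat.floor_div_eq_div]

/-- **The candidates of the pair of units `(2i, 2i+1)`**: `⌊p Q / c⌉` over the convergent numerators
`p` of `c/d`, `c, d` the characters of the two units, `Q = 2^L`, fuel `2L + 1`.
[cite: Jozsa2003, §10 (proof of Thm. 6: k as the numerator of a convergent of c/d, m = ⌊c_n q/c⌉)] -/
def pairCands (n : ℕ) (v : List Bool) (i : ℕ) : List ℕ :=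
  (numsOf (quots (hallgrenSS.charOf n v (2 * i)) (hallgrenSS.charOf n v (2 * i + 1)) (2 * LQ n + 1))).map
    fun p => rdiv (p * 2 ^ LQ n) (hallgrenSS.charOf n v (2 * i))

/-- The number of pairs of units, `2^43` — irreducible, so that no elaboration or kernel check ever
unfolds a `2^43`-long computation. [cite: Jozsa2003, §10 (repetition)] -/
irreducible_def NPAIRS : ℕ := 2 ^ 43

/-- All candidates, over the `2^43` pairs of units. [cite: Jozsa2003, §10 (repetition)] -/
def allCands (n : ℕ) (v : List Bool) : List ℕ := ((List.range NPAIRS).map (pairCands n v)).flatten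

/-- The state probed at shift `j` for the candidate `m`: `j` baby steps after the walk (on integer pairs)
to `m/N − 4/N`. [cite: Jozsa2003, §10 (c)] -/
def probeZ (x : List Bool) (m j : ℕ) : ZZ × ℚ :=
  ((walkZ (DOf x) (precP x.length)).babyStep)^[j]
    ((walkZ (DOf x) (precP x.length)).final ((((m : ℤ) - 4 : ℤ) : ℚ) / (Ngrid x.length : ℚ))
      (s0 x.length) (Tdbl x.length) (2 * Mfin x.length))

/-- The check at shift `j`: the probed ideal is `𝒪 = (unitP D, 2)` and its computed distance is
within `8/N` of `m/N`. [cite: Jozsa2003, §10 (c)] -/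
def chkB (x : List Bool) (m j : ℕ) : Bool :=
  decide ((probeZ x m j).1 = ((unitP (DOf x), 2) : ZZ)) &&
    decide (|(probeZ x m j).2 - (m : ℚ) / (Ngrid x.length : ℚ)| ≤ 8 / (Ngrid x.length : ℚ))

/-- **The test of a candidate** (some shift `j ≤ 2` checks; `HallgrenCandidateCheck.Passes` run on
integer pairs). [cite: Jozsa2003, §10 (requirement (c) of Thm. 6)] -/
def passesB (x : List Bool) (m : ℕ) : Bool := chkB x m 0 || (chkB x m 1 || chkB x m 2)

/-- Accepted candidates: at least `12` and passing the test. [cite: Jozsa2003, §10 (proof of Thm. 6)] -/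
def accB (x : List Bool) (m : ℕ) : Bool := decide (12 ≤ m) && passesB x m

/-- The least element of a list of naturals as a flag and a value (a left fold). [folklore] -/
def minAcc (l : List ℕ) : Bool × ℕ := l.foldl (fun a m => (true, if a.1 then min a.2 m else m)) (false, 0)

/-- The min-fold from a found value is `foldl min`. [folklore] -/
theorem foldl_minStep_true (l : List ℕ) (k : ℕ) :
    l.foldl (fun a m => ((true : Bool), if a.1 then min a.2 m else m)) (true, k) = (true, l.foldl min k) := by
  induction l generalizing k with
  | nil => rfl
  | cons m l ih => rw [List.foldl_cons, List.foldl_cons]; exact ih (min k m)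

/-- `minAcc` computes `List.min?`. [folklore] -/
theorem minAcc_eq (l : List ℕ) : minAcc l = match l.min? with | none => (false, 0) | some k => (true, k) := by
  cases l with
  | nil => rfl
  | cons m l =>
    rw [minAcc, List.foldl_cons, List.min?_cons']
    exact foldl_minStep_true l m

/-- **The selected candidate**: the least accepted one. [cite: Jozsa2003, §10 ("output the smallest such m")] -/
def sel (x : List Bool) (ms : List ℕ) : Bool × ℕ := minAcc (ms.filter (accB x))

/-- **The classical post-processor**: on input `x` and measured string `v`, the selected candidate
`m₀` rounded to `⌊m₀/N⌉`, written self-delimited; empty if none is accepted.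
[cite: Jozsa2003, §10 Thm. 6 (proof) and Thm. 7] -/
def post (x v : List Bool) : List Bool :=
  if (sel x (allCands x.length v)).1 then boolPair (encodeNat (rdiv (sel x (allCands x.length v)).2 (Ngrid x.length))) [] else []

/-! ### The classical post-processing is polynomial time -/

section FP

/-- Unary multiplication (a private copy of `QuantumComplexity.unMul_codeFP`). [cite: AroraBarak2009, §1.3] -/
private theorem unMul : CodeFP (pairE unE unE) unE (fun p => p.1 * p.2) :=
  ((ulength unitE).comp (unitsMul.comp ((replicateUnit.comp (fst unE unE)).pair
    (replicateUnit.comp (snd unE unE))))).congr fun p => by simp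

/-- Unary multiplication by a constant (a private copy of `CodeFPStrings.unMulConst`). [folklore] -/
private theorem unMulConst : ∀ c : ℕ, CodeFP unE unE (fun n => c * n)
  | 0 => (const unE 0).congr fun n => by simp
  | c + 1 => (unAdd.comp ((unMulConst c).pair (CodeFP.id unE))).congr fun n => by simp [add_mul]

/-- Comparison of rationals (a private copy of `CodeFP.ratLe`). [folklore] -/
private theorem ratLe : CodeFP (pairE encodeRat encodeRat) bitE (fun p => decide (p.1 ≤ p.2)) := by
  have hd : CodeFP (pairE encodeRat encodeRat) encodeRat (fun p => p.2 - p.1) := (ratSub'.comp ((snd _ _).pair (fst _ _)) :)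
  have hn : CodeFP (pairE encodeRat encodeRat) intE (fun p => (p.2 - p.1).num) := (ratNumDen.comp hd).fst'
  have h := (intLe.comp ((const _ (0 : ℤ)).pair hn) :)
  refine h.congr fun p => ?_
  show decide ((0 : ℤ) ≤ (p.2 - p.1).num) = decide (p.1 ≤ p.2)
  have : ((0 : ℤ) ≤ (p.2 - p.1).num) ↔ (p.1 ≤ p.2) := by rw [Rat.num_nonneg, sub_nonneg]
  simp only [this]

/-- A `CodeFP` map into a code read as a string. [folklore] -/
private theorem toStr {α β : Type} {eα : α → List Bool} {eβ : β → List Bool} {f : α → β} (h : CodeFP eα eβ f) :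
    CodeFP eα strE (fun a => eβ (f a)) := by
  obtain ⟨F, hF, hFe⟩ := h; exact ⟨F, hF, hFe⟩

/-! #### Parameters from the input length -/

/-- `aN` in unary. [folklore] -/
theorem aN_un : CodeFP unE unE aN := ((unAdd.comp ((unMulConst 2).pair (const unE 12))) :).congr fun _ => rfl
/-- `precP` in unary. [folklore] -/
theorem precP_un : CodeFP unE unE precP := ((unAdd.comp ((unMulConst 9).pair (const unE 75))) :).congr fun _ => rfl
/-- `Kb` in unary. [folklore] -/
theorem Kb_un : CodeFP unE unE Kb := by
  have h1 : CodeFP unE unE (fun n => n + 7) := (unAdd.comp ((CodeFP.id unE).pair (const unE 7)) :)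
  have h2 : CodeFP unE unE (fun n => 2 * n + 9) := (unAdd.comp ((unMulConst 2).pair (const unE 9)) :)
  have h3 : CodeFP unE unE (fun n => (n + 7) * (2 * n + 9)) := (unMul.comp (h1.pair h2) :)
  have h4 : CodeFP unE unE (fun n => (n + 7) * (2 * n + 9) + n + 3) :=
    (unAdd.comp ((unAdd.comp (h3.pair (CodeFP.id unE))).pair (const unE 3)) :)
  exact h4.congr fun _ => rfl
/-- `s0` in unary. [folklore] -/
theorem s0_un : CodeFP unE unE s0 := ((unAdd.comp (((unMulConst 12).comp Kb_un).pair (const unE 6))) :).congr fun _ => rfl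
/-- `Tdbl` in unary. [folklore] -/
theorem Tdbl_un : CodeFP unE unE Tdbl := ((unAdd.comp ((unMulConst 6).pair (const unE 31))) :).congr fun n => (Tdbl_eq n).symm
/-- `Mfin` in unary. [folklore] -/
theorem Mfin_un : CodeFP unE unE Mfin := by
  have h1 : CodeFP unE unE (fun n => 2 * Tdbl n + 3) := (unAdd.comp (((unMulConst 2).comp Tdbl_un).pair (const unE 3)) :)
  have h2 : CodeFP unE unE (fun n => Kb n + 1) := (unSucc.comp Kb_un :)
  have h3 : CodeFP unE unE (fun n => (2 * Tdbl n + 3) * (Kb n + 1)) := (unMul.comp (h1.pair h2) :)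
  have h4 : CodeFP unE unE (fun n => (2 * Tdbl n + 3) * (Kb n + 1) + (n + 4) + 1) :=
    (unSucc.comp (unAdd.comp (h3.pair (unAdd.comp ((CodeFP.id unE).pair (const unE 4))))) :)
  have h5 : CodeFP unE unE ResB := h4.congr fun n => rfl
  exact (((unMulConst 3).comp h5) :).congr fun _ => rfl
/-- `2 Mfin` in unary. [folklore] -/
theorem twoMfin_un : CodeFP unE unE (fun n => 2 * Mfin n) := ((unMulConst 2).comp Mfin_un :)
/-- `Ngrid` in binary from `1ⁿ`. [folklore] -/
theorem Ngrid_nat : CodeFP unE natE Ngrid := ((natPow.comp ((const unE 2).pair aN_un)) :).congr fun _ => rfl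

/-! #### The input number and the discriminant -/

/-- Bit access by a unary position (a private copy of `CodeFPStrings.strGetD`). [cite: AroraBarak2009, §1.3] -/
private theorem strGetD' : CodeFP (pairE unE strE) bitE (fun p => p.2.getD p.1 false) :=
  ⟨HashBricks.headBitFn ∘ bitAtFn, comp_mem_FP HashBricks.headBitFn_mem_FP bitAtFn_mem_FP, fun p => by
    rw [pairE_apply, Function.comp_apply, bitAtFn_boolPair, HashBricks.headBitFn_apply, length_unE]
    change [((p.2.drop p.1).take 1).headD false] = [p.2.getD p.1 false]
    rw [List.getD_eq_getElem?_getD, ← List.head?_drop]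
    cases p.2.drop p.1 <;> rfl⟩

/-- The canonical form of a numeral through its last bit. [folklore] -/
theorem canonBits_eq_ite (x : List Bool) :
    canonBits x = if (decide (0 < x.length) && !(x.getD (x.length - 1) false)) then x ++ [true] else x := by
  have key : x.getLast? = some false ↔ (decide (0 < x.length) && !(x.getD (x.length - 1) false)) = true := by
    induction x using List.reverseRecOn with
    | nil => simp
    | append_singleton l b _ =>
      have hlast : (l ++ [b]).getLast? = some b := by simp
      have hlen : (l ++ [b]).length = l.length + 1 := by simp
      have hget : (l ++ [b]).getD ((l ++ [b]).length - 1) false = b := by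
        rw [hlen, Nat.add_sub_cancel, List.getD_eq_getElem?_getD, List.getElem?_append_right (le_refl _), Nat.sub_self]
        simp
      rw [hlast, hget, hlen]
      cases b <;> simp
  unfold canonBits
  by_cases h : x.getLast? = some false
  · rw [if_pos h, if_pos (key.1 h)]
  · rw [if_neg h, if_neg (fun h' => h (key.2 h'))]

/-- **The input number `⟦x⟧` is read in polynomial time** (canonicalise, then take the value; the
statement of `SimultaneousApproxInstance.decodeNat_codeFP` of `NumberTheory/DiophantineApproximation`,
not imported here — a private copy with its own proof). [cite: AroraBarak2009, §1.3] -/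
private theorem decodeNat_str : CodeFP strE natE decodeNat := by
  have hn : CodeFP strE unE List.length := strLength
  have hpos : CodeFP strE bitE (fun x => decide (0 < x.length)) := (natLt.comp ((const _ 0).pair (natOfUn.comp hn)) :)
  have hidx : CodeFP strE unE (fun x => min (x.length - 1) x.length) := (unOfNatMin.comp (hn.pair (natSub.comp ((natOfUn.comp hn).pair (const _ 1)))) :)
  have hidx' : CodeFP strE unE (fun x => x.length - 1) := hidx.congr fun x => min_eq_left (Nat.sub_le _ _)
  have hb : CodeFP strE bitE (fun x => x.getD (x.length - 1) false) := (strGetD'.comp (hidx'.pair (CodeFP.id strE)) :)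
  have hcond : CodeFP strE bitE (fun x => decide (0 < x.length) && !(x.getD (x.length - 1) false)) := (hpos.and (hb.not) :)
  have happ : CodeFP strE strE (fun x => x ++ [true]) := (strAppend.comp ((CodeFP.id strE).pair (const strE [true])) :)
  have hcan0 : CodeFP strE strE (fun x => if (decide (0 < x.length) && !(x.getD (x.length - 1) false)) then x ++ [true] else x) :=
    hcond.ite happ (CodeFP.id strE)
  have hcan : CodeFP strE strE canonBits := hcan0.congr fun x => (canonBits_eq_ite x).symm
  exact ((strVal.comp hcan) :).congr fun x => bitsToNat_canonBits x

/-- **The discriminant is read in polynomial time.** [folklore] -/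
theorem DOf_str : CodeFP strE natE DOf := by
  have hd : CodeFP strE natE dOf := decodeNat_str
  have hc : CodeFP strE bitE (fun x => decide (dOf x % 4 = 1)) := (natEq.comp ((natMod.comp (hd.pair (const _ 4))).pair (const _ 1)) :)
  have h4 : CodeFP strE natE (fun x => 4 * dOf x) := (natMul.comp ((const _ 4).pair hd) :)
  have h : CodeFP strE natE (fun x => if decide (dOf x % 4 = 1) then dOf x else 4 * dOf x) := hc.ite hd h4
  exact h.congr fun x => by rw [DOf_eq]; by_cases hx : dOf x % 4 = 1 <;> simp [hx]

/-! #### The table -/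

/-- **The table of the input is polynomial time** (`principalTableC` with the parameters of the input). [cite: Jozsa2003, §9 Thm. 5, §10 Prop. 36 (ii)] -/
theorem tab_str : CodeFP (pairE strE natE) strE (fun p => tab p.1 p.2) := by
  have hx : CodeFP (pairE strE natE) strE (fun p => p.1) := fst _ _
  have hn : CodeFP (pairE strE natE) unE (fun p => p.1.length) := strLength.comp hx
  have hv : CodeFP (pairE strE natE) intE (fun p => (p.2 : ℤ)) := intOfNat.comp (snd _ _)
  have hD : CodeFP (pairE strE natE) natE (fun p => DOf p.1) := DOf_str.comp hx
  have hw : CodeFP (pairE strE natE) wE (fun p => (DOf p.1, precP p.1.length)) := (hD.pair (precP_un.comp hn) :)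
  have hpar : CodeFP (pairE strE natE) (pairE unE (pairE unE unE)) (fun p => (s0 p.1.length, (Tdbl p.1.length, 2 * Mfin p.1.length))) :=
    ((s0_un.comp hn).pair ((Tdbl_un.comp hn).pair (twoMfin_un.comp hn)) :)
  have hctx : CodeFP (pairE strE natE) tbE (fun p => (((DOf p.1, precP p.1.length), (s0 p.1.length, (Tdbl p.1.length, 2 * Mfin p.1.length))),
      (Ngrid p.1.length, (p.2 : ℤ)))) := ((hw.pair hpar).pair ((Ngrid_nat.comp hn).pair hv) :)
  have h := (principalTableC.comp hctx :)
  exact (toStr h).congr fun p => rfl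

/-! #### Characters, candidates -/

/-- The characters of the units, from `(x, v)` and the unit index. [cite: Kitaev1995, §3 Thm 1] -/
theorem charOf_str : CodeFP (pairE (pairE strE strE) natE) natE (fun c => hallgrenSS.charOf c.1.1.length c.1.2 c.2) := by
  have h := hallgrenSS.codeFP_charOf L_un Lv_un B_un
  have hctx : CodeFP (pairE (pairE strE strE) natE) (pairE (pairE unE strE) natE) (fun c => ((c.1.1.length, c.1.2), c.2)) :=
    (((strLength.comp (fst _ _).fst').pair (fst _ _).snd').pair (snd _ _) :)
  exact ((h.comp hctx) :).congr fun c => rfl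

/-- **The candidates of a pair of units are polynomial time.** [cite: Jozsa2003, §10 (proof of Thm. 6)] -/
theorem pairCands_str : CodeFP (pairE (pairE strE strE) natE) (rawE natE) (fun c => pairCands c.1.1.length c.1.2 c.2) := by
  have hn : CodeFP (pairE (pairE strE strE) natE) unE (fun c => c.1.1.length) := strLength.comp (fst _ _).fst'
  have hi : CodeFP (pairE (pairE strE strE) natE) natE (fun c => c.2) := snd _ _
  have h2i : CodeFP (pairE (pairE strE strE) natE) natE (fun c => 2 * c.2) := (natMul.comp ((const _ 2).pair hi) :)
  have h2i1 : CodeFP (pairE (pairE strE strE) natE) natE (fun c => 2 * c.2 + 1) := (natAdd.comp (h2i.pair (const _ 1)) :)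
  have hc : CodeFP (pairE (pairE strE strE) natE) natE (fun c => hallgrenSS.charOf c.1.1.length c.1.2 (2 * c.2)) :=
    (charOf_str.comp ((fst _ _).pair h2i) :)
  have hd : CodeFP (pairE (pairE strE strE) natE) natE (fun c => hallgrenSS.charOf c.1.1.length c.1.2 (2 * c.2 + 1)) :=
    (charOf_str.comp ((fst _ _).pair h2i1) :)
  have hfuel : CodeFP (pairE (pairE strE strE) natE) unE (fun c => 2 * LQ c.1.1.length + 1) :=
    (unSucc.comp ((unMulConst 2).comp (L_un.comp hn)) :)
  have hnums : CodeFP (pairE (pairE strE strE) natE) (rawE natE)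
      (fun c => numsOf (quots (hallgrenSS.charOf c.1.1.length c.1.2 (2 * c.2)) (hallgrenSS.charOf c.1.1.length c.1.2 (2 * c.2 + 1))
        (2 * LQ c.1.1.length + 1))) := (codeFP_convNums.comp (hc.pair (hd.pair hfuel)) :)
  have hQ : CodeFP (pairE (pairE strE strE) natE) natE (fun c => 2 ^ LQ c.1.1.length) := (natPow.comp ((const _ 2).pair (L_un.comp hn)) :)
  -- map `p ↦ rdiv (p Q) c` over the numerators
  have hitem : CodeFP (pairE (pairE (pairE strE strE) natE) natE) natE (fun t => rdiv (t.2 * 2 ^ LQ t.1.1.1.length) (hallgrenSS.charOf t.1.1.1.length t.1.1.2 (2 * t.1.2))) := by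
    have hp : CodeFP (pairE (pairE (pairE strE strE) natE) natE) natE (fun t => t.2) := snd _ _
    have hQ' : CodeFP (pairE (pairE (pairE strE strE) natE) natE) natE (fun t => 2 ^ LQ t.1.1.1.length) := hQ.comp (fst _ _)
    have hc' : CodeFP (pairE (pairE (pairE strE strE) natE) natE) natE (fun t => hallgrenSS.charOf t.1.1.1.length t.1.1.2 (2 * t.1.2)) := hc.comp (fst _ _)
    have hnum : CodeFP (pairE (pairE (pairE strE strE) natE) natE) natE (fun t => 2 * (t.2 * 2 ^ LQ t.1.1.1.length) + hallgrenSS.charOf t.1.1.1.length t.1.1.2 (2 * t.1.2)) :=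
      (natAdd.comp ((natMul.comp ((const _ 2).pair (natMul.comp (hp.pair hQ')))).pair hc') :)
    have hden : CodeFP (pairE (pairE (pairE strE strE) natE) natE) natE (fun t => 2 * hallgrenSS.charOf t.1.1.1.length t.1.1.2 (2 * t.1.2)) :=
      (natMul.comp ((const _ 2).pair hc') :)
    exact ((natDiv.comp (hnum.pair hden)) :).congr fun t => rfl
  have h := ((map hitem).comp ((CodeFP.id _).pair hnums) :)
  exact h.congr fun c => rfl

/-- **All candidates are polynomial time.** [folklore] -/
theorem allCands_str : CodeFP (pairE strE strE) (rawE natE) (fun c => allCands c.1.length c.2) := by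
  have hl : CodeFP (pairE strE strE) (rawE natE) (fun _ => List.range NPAIRS) := urange.comp (const _ NPAIRS)
  have hm := ((map pairCands_str).comp ((CodeFP.id _).pair hl) :)
  have hf := ((flatten natE).comp hm :)
  exact hf.congr fun c => rfl

/-! #### The test of a candidate -/

/-- Codes of integer pairs are injective. [folklore] -/
theorem zzE_injective : Function.Injective (zzE : ZZ → List Bool) := pairE_injective intE_injective intE_injective

/-- The walk to `m/N − 4/N`, then `j` baby steps, in polynomial time. [cite: Jozsa2003, §9 Thm. 5, §10 (c)] -/
theorem probeZ_str (j : ℕ) : CodeFP (pairE strE natE) stE (fun p => probeZ p.1 p.2 j) := by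
  have hx : CodeFP (pairE strE natE) strE (fun p => p.1) := fst _ _
  have hn : CodeFP (pairE strE natE) unE (fun p => p.1.length) := strLength.comp hx
  have hm : CodeFP (pairE strE natE) natE (fun p => p.2) := snd _ _
  have hw : CodeFP (pairE strE natE) wE (fun p => (DOf p.1, precP p.1.length)) := ((DOf_str.comp hx).pair (precP_un.comp hn) :)
  have hN : CodeFP (pairE strE natE) natE (fun p => Ngrid p.1.length) := Ngrid_nat.comp hn
  have hxq : CodeFP (pairE strE natE) encodeRat (fun p => ((((p.2 : ℤ) - 4 : ℤ)) : ℚ) / (Ngrid p.1.length : ℚ)) :=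
    (ratOfIntNat.comp ((intSub.comp ((intOfNat.comp hm).pair (const _ (4 : ℤ)))).pair hN) :)
  have hctx : CodeFP (pairE strE natE) (pairE dcE unE)
      (fun p => ((((DOf p.1, precP p.1.length), ((((p.2 : ℤ) - 4 : ℤ)) : ℚ) / (Ngrid p.1.length : ℚ)),
        (s0 p.1.length, Tdbl p.1.length)), 2 * Mfin p.1.length)) :=
    (((hw.pair hxq).pair ((s0_un.comp hn).pair (Tdbl_un.comp hn))).pair (twoMfin_un.comp hn) :)
  have hfin : CodeFP (pairE strE natE) stE (fun p => probeZ p.1 p.2 0) := ((finalC.comp hctx) :).congr fun p => rfl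
  induction j with
  | zero => exact hfin
  | succ j ih =>
    have h := ((babyStepC.comp (hw.pair ih)) :)
    exact h.congr fun p => by simp only [probeZ, Function.iterate_succ_apply']

/-- The check at shift `j` is polynomial time. [folklore] -/
theorem chkB_str (j : ℕ) : CodeFP (pairE strE natE) bitE (fun p => chkB p.1 p.2 j) := by
  have hx : CodeFP (pairE strE natE) strE (fun p => p.1) := fst _ _
  have hn : CodeFP (pairE strE natE) unE (fun p => p.1.length) := strLength.comp hx
  have hm : CodeFP (pairE strE natE) natE (fun p => p.2) := snd _ _
  have hN : CodeFP (pairE strE natE) natE (fun p => Ngrid p.1.length) := Ngrid_nat.comp hn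
  have hpr := probeZ_str j
  have hunit : CodeFP (pairE strE natE) zzE (fun p => ((unitP (DOf p.1), 2) : ZZ)) := (unitZC.comp (DOf_str.comp hx) :)
  have heq : CodeFP (pairE strE natE) bitE (fun p => decide ((probeZ p.1 p.2 j).1 = ((unitP (DOf p.1), 2) : ZZ))) :=
    ((CodeFP.eq zzE_injective).comp (hpr.fst'.pair hunit) :)
  have hmN : CodeFP (pairE strE natE) encodeRat (fun p => ((p.2 : ℤ) : ℚ) / (Ngrid p.1.length : ℚ)) := (ratOfIntNat.comp ((intOfNat.comp hm).pair hN) :)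
  have h8N : CodeFP (pairE strE natE) encodeRat (fun p => ((8 : ℤ) : ℚ) / (Ngrid p.1.length : ℚ)) := (ratOfIntNat.comp ((const _ (8 : ℤ)).pair hN) :)
  have habs : CodeFP (pairE strE natE) encodeRat (fun p => |(probeZ p.1 p.2 j).2 - ((p.2 : ℤ) : ℚ) / (Ngrid p.1.length : ℚ)|) :=
    (ratAbs'.comp (ratSub'.comp (hpr.snd'.pair hmN)) :)
  have hle : CodeFP (pairE strE natE) bitE (fun p => decide (|(probeZ p.1 p.2 j).2 - ((p.2 : ℤ) : ℚ) / (Ngrid p.1.length : ℚ)| ≤ ((8 : ℤ) : ℚ) / (Ngrid p.1.length : ℚ))) :=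
    (ratLe.comp (habs.pair h8N) :)
  have h := (heq.and hle :)
  exact h.congr fun p => by simp only [chkB]; push_cast; rfl

/-- The test and the acceptance of a candidate are polynomial time. [folklore] -/
theorem accB_str : CodeFP (pairE strE natE) bitE (fun p => accB p.1 p.2) := by
  have hpass : CodeFP (pairE strE natE) bitE (fun p => passesB p.1 p.2) := (((chkB_str 0).or ((chkB_str 1).or (chkB_str 2))) :).congr fun p => rfl
  have h12 : CodeFP (pairE strE natE) bitE (fun p => decide (12 ≤ p.2)) := (natLe.comp ((const _ 12).pair (snd _ _)) :)
  exact ((h12.and hpass) :).congr fun p => rfl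

/-! #### Selection and output -/

/-- The least accepted candidate is polynomial time. [folklore] -/
theorem sel_str : CodeFP (pairE strE (rawE natE)) (pairE bitE natE) (fun p => sel p.1 p.2) := by
  have hflt : CodeFP (pairE strE (rawE natE)) (rawE natE) (fun p => p.2.filter (accB p.1)) := (filter accB_str :)
  -- the min-fold (no context needed): item `m`, accumulator `(flag, value)`
  have hstep : CodeFP (pairE natE (pairE bitE natE)) (pairE bitE natE) (fun t => ((true : Bool), if t.2.1 then min t.2.2 t.1 else t.1)) := by
    have hb : CodeFP (pairE natE (pairE bitE natE)) bitE (fun t => t.2.1) := (snd _ _).fst'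
    have hk : CodeFP (pairE natE (pairE bitE natE)) natE (fun t => t.2.2) := (snd _ _).snd'
    have hm : CodeFP (pairE natE (pairE bitE natE)) natE (fun t => t.1) := fst _ _
    have hmin : CodeFP (pairE natE (pairE bitE natE)) natE (fun t => min t.2.2 t.1) := (natMin.comp (hk.pair hm) :)
    have hv : CodeFP (pairE natE (pairE bitE natE)) natE (fun t => if t.2.1 then min t.2.2 t.1 else t.1) := hb.ite hmin hm
    exact ((const _ true).pair hv :)
  have hfold := foldl₀ (eα := natE) (eβ := pairE bitE natE)
    (step := fun (m : ℕ) (a : Bool × ℕ) => ((true : Bool), if a.1 then min a.2 m else m)) (b₀ := ((false : Bool), 0)) hstep (X + 8)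
    (fun l₁ l₂ => by
      simp only [eval_add, eval_X, eval_ofNat]
      -- the value is `0` or an element of `l₁`
      have hmem : ∀ (l : List ℕ) (a : Bool × ℕ), (l.foldl (fun b a' => ((true : Bool), if b.1 then min b.2 a' else a')) a).2 = a.2 ∨
          (l.foldl (fun b a' => ((true : Bool), if b.1 then min b.2 a' else a')) a).2 ∈ l := by
        intro l
        induction l with
        | nil => intro a; left; rfl
        | cons m l ih =>
          intro a
          rw [List.foldl_cons]
          rcases ih ((true : Bool), if a.1 then min a.2 m else m) with h | h
          · rw [h]
            simp only
            split_ifs with hb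
            · rcases Nat.le_total a.2 m with hh | hh
              · left; exact min_eq_left hh
              · right; rw [min_eq_right hh]; exact List.mem_cons_self
            · right; exact List.mem_cons_self
          · right; exact List.mem_cons_of_mem _ h
      have hval : (natE (l₁.foldl (fun b a' => ((true : Bool), if b.1 then min b.2 a' else a')) ((false : Bool), 0)).2).length ≤
          (rawE natE (l₁ ++ l₂)).length := by
        rcases hmem l₁ ((false : Bool), 0) with h | h
        · rw [h]; simp
        · have := length_item_le_length_rawE natE (List.mem_append_left l₂ h); omega
      rw [pairE_apply, length_boolPair]
      have : (bitE (l₁.foldl (fun b a' => ((true : Bool), if b.1 then min b.2 a' else a')) ((false : Bool), 0)).1).length = 1 := rfl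
      omega)
  have h := (hfold.comp hflt :)
  exact h.congr fun p => rfl

/-- **The post-processor is polynomial time.** [cite: Jozsa2003, §10 Thm. 6 (proof: every classical step is poly(log S))] -/
theorem post_str : CodeFP (pairE strE strE) strE (fun c => post c.1 c.2) := by
  have hx : CodeFP (pairE strE strE) strE (fun c => c.1) := fst _ _
  have hn : CodeFP (pairE strE strE) unE (fun c => c.1.length) := strLength.comp hx
  have hsel : CodeFP (pairE strE strE) (pairE bitE natE) (fun c => sel c.1 (allCands c.1.length c.2)) := (sel_str.comp (hx.pair allCands_str) :)
  have hb : CodeFP (pairE strE strE) bitE (fun c => (sel c.1 (allCands c.1.length c.2)).1) := hsel.fst'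
  have hr : CodeFP (pairE strE strE) natE (fun c => rdiv (sel c.1 (allCands c.1.length c.2)).2 (Ngrid c.1.length)) := by
    have hm : CodeFP (pairE strE strE) natE (fun c => (sel c.1 (allCands c.1.length c.2)).2) := hsel.snd'
    have hN : CodeFP (pairE strE strE) natE (fun c => Ngrid c.1.length) := Ngrid_nat.comp hn
    have hnum : CodeFP (pairE strE strE) natE (fun c => 2 * (sel c.1 (allCands c.1.length c.2)).2 + Ngrid c.1.length) :=
      (natAdd.comp ((natMul.comp ((const _ 2).pair hm)).pair hN) :)
    have hden : CodeFP (pairE strE strE) natE (fun c => 2 * Ngrid c.1.length) := (natMul.comp ((const _ 2).pair hN) :)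
    exact ((natDiv.comp (hnum.pair hden)) :).congr fun c => rfl
  have hout : CodeFP (pairE strE strE) strE (fun c => boolPair (encodeNat (rdiv (sel c.1 (allCands c.1.length c.2)).2 (Ngrid c.1.length))) []) :=
    (toStr (hr.pair (const _ ([] : List Bool))) : CodeFP (pairE strE strE) strE (fun c => pairE natE strE (rdiv (sel c.1 (allCands c.1.length c.2)).2 (Ngrid c.1.length), [])))
  have h : CodeFP (pairE strE strE) strE (fun c => if (sel c.1 (allCands c.1.length c.2)).1 then
      boolPair (encodeNat (rdiv (sel c.1 (allCands c.1.length c.2)).2 (Ngrid c.1.length))) [] else []) := hb.ite hout (const _ [])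
  exact h.congr fun c => by simp only [post]

/-- **The post-processor as a string function of `⟨x, v⟩`.** [cite: BernsteinVazirani1997, §8] -/
theorem exists_post_fn : ∃ g : List Bool → List Bool, g ∈ FP ∧ ∀ x v, g (boolPair x v) = post x v := by
  obtain ⟨g, hg, hge⟩ := post_str
  refine ⟨g, hg, fun x v => ?_⟩
  have h := hge (x, v)
  -- normalise the codes syntactically (never unfold `post`: its body is a huge closed computation)
  simp only [pairE_apply, strE, id_eq] at h
  exact h

end FP

/-! ### The instance of a promise input -/

section Instance

variable (x : List Bool)

/-- The input length. [folklore] -/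
abbrev nx : ℕ := x.length

/-- `⟦x⟧ < 2^{|x|+1}` (through the canonical numeral). [folklore] -/
theorem dOf_lt : dOf x < 2 ^ (x.length + 1) := by
  rw [dOf, ← bitsToNat_canonBits]
  refine (bitsToNat_lt _).trans_le (Nat.pow_le_pow_right (by norm_num) ?_)
  unfold canonBits; split_ifs <;> simp

/-- `D < 2^{|x|+3}`. [folklore] -/
theorem DOf_lt : DOf x < 2 ^ (x.length + 3) := by
  rw [DOf_eq]
  have := dOf_lt x
  split_ifs <;> · rw [show x.length + 3 = (x.length + 1) + 2 by omega, pow_add]; omega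

/-- `fundDiscr d ≥ 0`. [folklore] -/
theorem fundDiscr_nonneg' (d : ℕ) : 0 ≤ fundDiscr d := by unfold fundDiscr; split_ifs <;> positivity

/-- `D ≡ 0, 1 (mod 4)`. [cite: Jozsa2003, §3 Thm 2] -/
theorem DOf_mod_four : DOf x % 4 = 0 ∨ DOf x % 4 = 1 := Quadratic.fundDiscr_toNat_mod_four _

/-- The grid size as a real number. [folklore] -/
theorem Ngrid_real (n : ℕ) : ((Ngrid n : ℕ) : ℝ) = 2 ^ aN n := by simp [Ngrid]

/-- `N ≥ 4096`. [folklore] -/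
theorem Ngrid_ge (n : ℕ) : (4096 : ℝ) ≤ Ngrid n := by
  rw [Ngrid_real, aN]
  calc (4096 : ℝ) = 2 ^ 12 := by norm_num
    _ ≤ 2 ^ (2 * n + 12) := pow_le_pow_right₀ (by norm_num) (by omega)

/-- The precision is adequate: `η ≤ 1/8`. [cite: Jozsa2003, §9 Thm. 5] -/
theorem etaR_le_eighth : etaR (DOf x) (precP x.length) ≤ 1 / 8 :=
  etaR_le _ (size_Ks_le_prec (DOf_lt x))

variable {x} (hsf : Squarefree (dOf x)) (h2 : 2 ≤ dOf x)
include hsf h2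

/-- A promise input is nonempty. [folklore] -/
theorem one_le_length : 1 ≤ x.length := by
  rcases x with _ | ⟨b, l⟩
  · exfalso; simp [dOf, decodeNat, decodeNum] at h2
  · simp

/-- `D` is not a square. [cite: Jozsa2003, §3 Thm 2] -/
theorem not_isSquare_DOf : ¬ IsSquare (DOf x) := Quadratic.not_isSquare_fundDiscr_toNat hsf h2

/-- `D` is a fundamental discriminant. [cite: Jozsa2003, §3 Thm 2] -/
theorem isFundDiscr_DOf : IsFundDiscr (DOf x) := by
  have h := Quadratic.isFundamental_fundDiscr hsf h2
  have hnn := fundDiscr_nonneg' (dOf x)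
  have hcast : (fundDiscr (dOf x) : ℤ) = ((DOf x : ℕ) : ℤ) := by rw [DOf, Int.toNat_of_nonneg hnn]
  unfold IsFundDiscr
  rcases h with ⟨h1, hsq, -⟩ | ⟨h4, hm, hsq⟩
  · left
    rw [hcast] at h1 hsq
    exact ⟨by exact_mod_cast h1, by rwa [Int.squarefree_natCast] at hsq⟩
  · right
    rw [hcast] at h4 hm hsq
    have h4' : 4 ∣ DOf x := by exact_mod_cast h4
    have hdiv : ((DOf x : ℕ) : ℤ) / 4 = ((DOf x / 4 : ℕ) : ℤ) := by
      obtain ⟨c, hc⟩ := h4'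
      rw [hc]; push_cast; simp
    rw [hdiv] at hm hsq
    refine ⟨h4', ?_, by rwa [Int.squarefree_natCast] at hsq⟩
    rcases hm with hm | hm
    · left; exact_mod_cast hm
    · right; exact_mod_cast hm

/-- **The infrastructure of the input**: the principal cycle of `D` with fixed-point evaluators.
[cite: Jozsa2003, §6–§7, §9 Thm. 5] -/
def Gx : GiantStepCycle (QuadIrr (DOf x)) :=
  principalGSC (DOf x) (precP x.length) (not_isSquare_DOf hsf h2) (isFundDiscr_DOf hsf h2) (etaR_le_eighth x)

/-- Its walk data is `Wx x`. [folklore] -/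
theorem Gx_toWalkData : (Gx hsf h2).toWalkData = Wx x := rfl

/-- The regulator field is `log ε_D`. [folklore] -/
theorem Gx_R : (Gx hsf h2).R = Real.log (fundUnit (DOf x)) := rfl

/-- **The regulator of any admissible field is `G.R`.** [cite: Jozsa2003, §3 with §6.3 Thm. 4(b)] -/
theorem regulator_eq_R {K : Type*} [Field K] [NumberField K] (hK : Module.finrank ℚ K = 2) {α : K}
    (hα : α ^ 2 = (decodeNat x : K)) : NumberField.Units.regulator K = (Gx hsf h2).R := by
  rw [Gx_R]
  exact Quadratic.regulator_eq_log_fundUnit_fundDiscr hK hsf h2 hα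

/-! #### Numeric bounds -/

/-- `R > 1/3`. [cite: Jozsa2003, §7 Prop. 32] -/
theorem R_gt : 1 / 3 < (Gx hsf h2).R := log_fundUnit_gt_third (not_isSquare_DOf hsf h2) (DOf_mod_four x)

/-- `R < 2^{2n+8}`. [cite: Jozsa2003, §6.3 Prop. 30, §7 Prop. 31] -/
theorem R_lt : (Gx hsf h2).R < 2 ^ (2 * x.length + 8) := by
  have h := log_fundUnit_lt (not_isSquare_DOf hsf h2) (DOf_mod_four x)
  rw [Gx_R]
  have hD : ((DOf x : ℕ) : ℝ) + 1 ≤ 2 ^ (x.length + 3) := by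
    have : (DOf x : ℕ) + 1 ≤ 2 ^ (x.length + 3) := DOf_lt x
    exact_mod_cast this
  have hD0 : (0 : ℝ) ≤ DOf x := by positivity
  have hP1 : (1 : ℝ) ≤ 2 ^ (x.length + 3) := one_le_pow₀ (by norm_num)
  have h1 : (3 : ℝ) * (DOf x) * ((DOf x : ℝ) + 1) + 1 ≤ 3 * (2 ^ (x.length + 3) * 2 ^ (x.length + 3)) + 1 := by nlinarith
  have hpow : (2 : ℝ) ^ (2 * x.length + 8) = 4 * (2 ^ (x.length + 3) * 2 ^ (x.length + 3)) := by
    rw [← pow_add, show 2 * x.length + 8 = 2 + ((x.length + 3) + (x.length + 3)) by ring, pow_add]; norm_num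
  have hP : (1 : ℝ) ≤ 2 ^ (x.length + 3) * 2 ^ (x.length + 3) := by nlinarith
  rw [hpow]; linarith

/-- **`S = N R ≥ 5000`** for a promise input (`n ≥ 1`). [folklore] -/
theorem S_ge : (5000 : ℝ) ≤ Ngrid x.length * (Gx hsf h2).R := by
  have hR := R_gt hsf h2
  have hn := one_le_length hsf h2
  have hN : (16384 : ℝ) ≤ Ngrid x.length := by
    rw [Ngrid_real, aN]
    calc (16384 : ℝ) = 2 ^ 14 := by norm_num
      _ ≤ 2 ^ (2 * x.length + 12) := pow_le_pow_right₀ (by norm_num) (by omega)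
  nlinarith

/-- `S < 2^{4n+20}`. [folklore] -/
theorem S_lt : Ngrid x.length * (Gx hsf h2).R < 2 ^ (4 * x.length + 20) := by
  have hR := R_lt hsf h2
  have hR0 : 0 < (Gx hsf h2).R := by have := R_gt hsf h2; linarith
  rw [Ngrid_real, show 4 * x.length + 20 = aN x.length + (2 * x.length + 8) by unfold aN; ring, pow_add]
  exact mul_lt_mul_of_pos_left hR (by positivity)

/-- `Q = 2^L ≥ 3 S²` (indeed `Q = 4 · (2^{4n+20})²`). [cite: Jozsa2003, §10 Thm. 6 (q ≥ 3S²)] -/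
theorem three_S_sq_le_Q : 3 * (Ngrid x.length * (Gx hsf h2).R) ^ 2 ≤ (2 : ℝ) ^ LQ x.length := by
  have hS := S_lt hsf h2
  have hS0 : 0 ≤ Ngrid x.length * (Gx hsf h2).R := by have := S_ge hsf h2; linarith
  have h1 : (Ngrid x.length * (Gx hsf h2).R) ^ 2 ≤ (2 ^ (4 * x.length + 20)) ^ 2 := pow_le_pow_left₀ hS0 hS.le 2
  have hL : (2 : ℝ) ^ LQ x.length = 4 * (2 ^ (4 * x.length + 20)) ^ 2 := by
    rw [show LQ x.length = (4 * x.length + 20) + (4 * x.length + 20) + 2 by unfold LQ; ring, pow_add, pow_add]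
    norm_num; ring
  rw [hL]
  nlinarith [pow_pos (show (0:ℝ) < 2 ^ (4 * x.length + 20) by positivity) 2]

/-- **`K ≤ Kb(n)`.** [cite: Jozsa2003, §7.1 Prop. 35] -/
theorem K_le : ((Gx hsf h2).K : ℝ) ≤ Kb x.length := by
  show ((Kq (DOf x) : ℚ) : ℝ) ≤ Kb x.length
  have h := Kq_nat_le_Kb (DOf_lt x)
  unfold Kq Ks
  exact_mod_cast h

/-- `K ≥ 0`. [folklore] -/
theorem K_nonneg : (0 : ℝ) ≤ (Gx hsf h2).K := (Gx hsf h2).K_nonneg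

/-- **`η ≤ (n + 10) 2^{−prec}`.** [cite: Jozsa2003, §9 Thm. 5] -/
theorem eta_le : (Gx hsf h2).η ≤ ((x.length + 10 : ℕ) : ℝ) * (1 / 2) ^ precP x.length := by
  show etaR (DOf x) (precP x.length) ≤ _
  unfold etaR
  have h := Ks_add_three_le (DOf_lt x)
  unfold Ks at h ⊢
  have : ((Nat.log 4 (2 * DOf x) + 3 + 3 : ℕ) : ℝ) ≤ ((x.length + 10 : ℕ) : ℝ) := by exact_mod_cast h
  have h0 : (0 : ℝ) ≤ (1 / 2) ^ precP x.length := by positivity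
  nlinarith

/-- `η ≥ 0`, `η ≤ 1/8`. [folklore] -/
theorem eta_bounds : 0 ≤ (Gx hsf h2).η ∧ (Gx hsf h2).η ≤ 1 / 8 := ⟨(Gx hsf h2).η_nonneg, (Gx hsf h2).η_le⟩

/-- `G.G ≤ Gb(n)`. [cite: Jozsa2003, §7 Prop. 31] -/
theorem GG_le : (Gx hsf h2).G ≤ Gb x.length := by
  show (1 : ℝ) + (Nat.size (DOf x) : ℝ) ≤ ((Gb x.length : ℕ) : ℝ)
  have h := G_le_Gb (DOf_lt x)
  exact_mod_cast h

/-- `G.L = ln 2`. [folklore] -/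
theorem GL_eq : (Gx hsf h2).L = Real.log 2 := rfl

/-- `ln 2 − 2η ≥ 3/8`. [folklore] -/
theorem L_sub_two_eta_ge : (3 : ℝ) / 8 ≤ (Gx hsf h2).L - 2 * (Gx hsf h2).η := by
  rw [GL_eq]
  have := (eta_bounds hsf h2).2
  have := Real.log_two_gt_d9
  linarith

end Instance
/-! ### Adequacy of the walk parameters -/

section Walk

variable {x : List Bool} (hsf : Squarefree (dOf x)) (h2 : 2 ≤ dOf x)
include hsf h2

/-- **The start-up freezes**: `2K + 1 ≤ d̂(I₀)` after `s₀ = 12 Kb + 6` rounds. [cite: Jozsa2003, §9 (proof of Thm. 5)] -/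
theorem start_ge : 2 * (Gx hsf h2).K + 1 ≤ ((Gx hsf h2).start (s0 x.length)).2 := by
  refine (Gx hsf h2).le_start (j := 6 * Kb x.length + 3) ?_ (by unfold s0; omega)
  have hK := K_le hsf h2
  have hL := L_sub_two_eta_ge hsf h2
  have hj : ((6 * Kb x.length + 3 : ℕ) : ℝ) = 6 * (Kb x.length : ℝ) + 3 := by push_cast; ring
  rw [hj]
  have hK0 := K_nonneg hsf h2
  nlinarith

/-- **The doubling depth is adequate**: every `y ≤ 2^{L−a}` (in particular every grid target `≤ Q/N`)
is within `d̂(I_T)`, `T = L − a + 1`. [cite: Jozsa2003, §9 (proof of Thm. 5)] -/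
theorem le_dbl {y : ℝ} (hy : y ≤ (2 : ℝ) ^ (LQ x.length - aN x.length)) : y ≤ ((Gx hsf h2).dbl (s0 x.length) (Tdbl x.length)).2 := by
  refine (Gx hsf h2).le_dbl_of_le_two_pow (start_ge hsf h2) ?_
  have hT : Tdbl x.length = (LQ x.length - aN x.length) + 1 := rfl
  rw [hT, pow_succ]
  have : (0 : ℝ) ≤ 2 ^ (LQ x.length - aN x.length) := by positivity
  nlinarith

omit hsf h2 in
/-- `Q/N = 2^{L−a}`. [folklore] -/
theorem Q_div_N (x : List Bool) : (2 : ℝ) ^ LQ x.length / Ngrid x.length = 2 ^ (LQ x.length - aN x.length) := by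
  rw [Ngrid_real, div_eq_iff (by positivity), ← pow_add, Nat.sub_add_cancel]
  unfold LQ aN; omega

/-- **The final rounds are adequate**: `Res < M (ln 2 − 2η)`. [cite: Jozsa2003, §9 (proof of Thm. 5)] -/
theorem Res_lt_M : (Gx hsf h2).Res (s0 x.length) (Tdbl x.length) < Mfin x.length * ((Gx hsf h2).L - 2 * (Gx hsf h2).η) := by
  have hRes := (Gx hsf h2).Res_le (s0 x.length) (Tdbl x.length)
  have hK := K_le hsf h2
  have hK0 := K_nonneg hsf h2
  have hη := (eta_bounds hsf h2)
  have hG := GG_le hsf h2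
  have hL := L_sub_two_eta_ge hsf h2
  have hM : ((Mfin x.length : ℕ) : ℝ) = 3 * ((2 * (Tdbl x.length : ℝ) + 3) * ((Kb x.length : ℝ) + 1) + Gb x.length + 1) := by
    unfold Mfin ResB; push_cast; ring
  have hT0 : (0 : ℝ) ≤ Tdbl x.length := by positivity
  set T : ℝ := (Tdbl x.length : ℝ)
  set KB : ℝ := (Kb x.length : ℝ)
  set GB : ℝ := (Gb x.length : ℝ)
  have hRB0 : (0 : ℝ) ≤ 3 * ((2 * T + 3) * (KB + 1) + GB + 1) := by positivity
  have hM38 : 3 * ((2 * T + 3) * (KB + 1) + GB + 1) * (3 / 8) ≤ 3 * ((2 * T + 3) * (KB + 1) + GB + 1) * ((Gx hsf h2).L - 2 * (Gx hsf h2).η) :=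
    mul_le_mul_of_nonneg_left hL hRB0
  have hKη : (Gx hsf h2).K + (Gx hsf h2).η ≤ KB + 1 / 8 := by linarith [hη.2]
  have hTK : T * (2 * ((Gx hsf h2).K + (Gx hsf h2).η)) ≤ T * (2 * (KB + 1 / 8)) := mul_le_mul_of_nonneg_left (by linarith) hT0
  rw [hM]
  have hKB0 : 0 ≤ KB := by positivity
  have hGB0 : 0 ≤ GB := by positivity
  nlinarith [hη.1, hη.2]

set_option maxHeartbeats 1000000 in
/-- **The accumulated distance error is below `2/N` (with the two extra `η`'s)**: `N (E_tot + 2η) ≤ 2`.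
[cite: Jozsa2003, §9 Thm. 5 (sufficient accuracy)] -/
theorem N_mul_Etot_le : (Ngrid x.length : ℝ) * ((Gx hsf h2).Etot (s0 x.length) (Tdbl x.length) (2 * Mfin x.length) + 2 * (Gx hsf h2).η) ≤ 2 := by
  have hE := (Gx hsf h2).Etot_le (s0 x.length) (Tdbl x.length) (2 * Mfin x.length)
  have hη := eta_le hsf h2
  have hη0 := (eta_bounds hsf h2).1
  have hkey := prec_key x.length
  have hkeyR : ((2 ^ aN x.length * (Tdbl x.length * 2 ^ Tdbl x.length * (s0 x.length + 1) + Tdbl x.length + 2 * Mfin x.length + 3) *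
      (x.length + 10) : ℕ) : ℝ) ≤ ((2 * 2 ^ precP x.length : ℕ) : ℝ) := by exact_mod_cast hkey
  push_cast at hkeyR hE
  rw [Ngrid_real]
  have hEt : (Gx hsf h2).Etot (s0 x.length) (Tdbl x.length) (2 * Mfin x.length) + 2 * (Gx hsf h2).η ≤
      ((Tdbl x.length : ℝ) * 2 ^ Tdbl x.length * ((s0 x.length : ℝ) + 1) + Tdbl x.length + 2 * (Mfin x.length : ℝ) + 3) * (Gx hsf h2).η := by
    linarith
  have hT0 : (0 : ℝ) ≤ Tdbl x.length := Nat.cast_nonneg _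
  have hs0 : (0 : ℝ) ≤ s0 x.length := Nat.cast_nonneg _
  have hM0 : (0 : ℝ) ≤ Mfin x.length := Nat.cast_nonneg _
  have hP0 : (0 : ℝ) ≤ 2 ^ Tdbl x.length := pow_nonneg (by norm_num) _
  have hprod : (0 : ℝ) ≤ (Tdbl x.length : ℝ) * 2 ^ Tdbl x.length * ((s0 x.length : ℝ) + 1) :=
    mul_nonneg (mul_nonneg hT0 hP0) (by linarith)
  have hC0 : (0 : ℝ) ≤ (Tdbl x.length : ℝ) * 2 ^ Tdbl x.length * ((s0 x.length : ℝ) + 1) + Tdbl x.length + 2 * (Mfin x.length : ℝ) + 3 := by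
    linarith
  have hEt2 : (Gx hsf h2).Etot (s0 x.length) (Tdbl x.length) (2 * Mfin x.length) + 2 * (Gx hsf h2).η ≤
      ((Tdbl x.length : ℝ) * 2 ^ Tdbl x.length * ((s0 x.length : ℝ) + 1) + Tdbl x.length + 2 * (Mfin x.length : ℝ) + 3) *
        ((((x.length + 10 : ℕ)) : ℝ) * (1 / 2) ^ precP x.length) :=
    hEt.trans (mul_le_mul_of_nonneg_left hη hC0)
  have hpow : (2 : ℝ) ^ precP x.length * (1 / 2) ^ precP x.length = 1 := by rw [← mul_pow]; norm_num
  have h2a : (0 : ℝ) ≤ 2 ^ aN x.length := pow_nonneg (by norm_num) _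
  have hhalf : (0 : ℝ) ≤ (1 / 2) ^ precP x.length := pow_nonneg (by norm_num) _
  calc (2 : ℝ) ^ aN x.length * ((Gx hsf h2).Etot (s0 x.length) (Tdbl x.length) (2 * Mfin x.length) + 2 * (Gx hsf h2).η)
      ≤ 2 ^ aN x.length * (((Tdbl x.length : ℝ) * 2 ^ Tdbl x.length * ((s0 x.length : ℝ) + 1) + Tdbl x.length + 2 * (Mfin x.length : ℝ) + 3) *
        ((((x.length + 10 : ℕ)) : ℝ) * (1 / 2) ^ precP x.length)) := mul_le_mul_of_nonneg_left hEt2 h2a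
    _ = (2 ^ aN x.length * ((Tdbl x.length : ℝ) * 2 ^ Tdbl x.length * ((s0 x.length : ℝ) + 1) + Tdbl x.length + 2 * (Mfin x.length : ℝ) + 3) *
        (((x.length + 10 : ℕ)) : ℝ)) * (1 / 2) ^ precP x.length := by ring
    _ ≤ (2 * 2 ^ precP x.length) * (1 / 2) ^ precP x.length := by
        apply mul_le_mul_of_nonneg_right _ hhalf
        push_cast
        linarith
    _ = 2 := by rw [mul_assoc, hpow, mul_one]

/-- Consequences: `N E_tot ≤ 2`, `N η ≤ 1`, `E_tot, η` are tiny. [folklore] -/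
theorem Etot_small : (Ngrid x.length : ℝ) * (Gx hsf h2).Etot (s0 x.length) (Tdbl x.length) (2 * Mfin x.length) ≤ 2 ∧
    (Ngrid x.length : ℝ) * (Gx hsf h2).η ≤ 1 := by
  have h := N_mul_Etot_le hsf h2
  have hη0 := (eta_bounds hsf h2).1
  have hE0 : 0 ≤ (Gx hsf h2).Etot (s0 x.length) (Tdbl x.length) (2 * Mfin x.length) := by
    unfold GiantStepCycle.Etot; have := (Gx hsf h2).Edesc_nonneg (s0 x.length) (Tdbl x.length) 0; positivity
  have hN : (0 : ℝ) ≤ Ngrid x.length := by positivity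
  constructor <;> nlinarith

end Walk
/-! ### Fourier sampling of the walk table: heavy harmonics, two coprime samples, many pairs -/

section Sampling

variable {x : List Bool} (hsf : Squarefree (dOf x)) (h2 : 2 ≤ dOf x)
include hsf h2

/-- The window `V = Q − 1` is within the walk's range. [folklore] -/
theorem hV_range : ((((2 ^ LQ x.length - 1 : ℕ) : ℤ) : ℝ) / Ngrid x.length) ≤ ((Gx hsf h2).dbl (s0 x.length) (Tdbl x.length)).2 := by
  refine le_dbl hsf h2 ?_
  rw [← Q_div_N x]
  apply div_le_div_of_nonneg_right _ (by positivity)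
  have : ((2 ^ LQ x.length - 1 : ℕ) : ℝ) ≤ ((2 ^ LQ x.length : ℕ) : ℝ) := by exact_mod_cast Nat.sub_le _ _
  push_cast at this ⊢; linarith

/-- **The walk table of the input is a blurred gap table** on `[0, Q)`. [cite: Jozsa2003, §10 Prop. 36] -/
def Tb : BlurredGapTable (QuadIrr (DOf x)) :=
  (Gx hsf h2).blurred (Ngrid_pos x.length) (hV_range hsf h2) (Res_lt_M hsf h2)

/-- Its pitch is `S = N R`. [folklore] -/
theorem Tb_S : (Tb hsf h2).S = Ngrid x.length * (Gx hsf h2).R := rfl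
/-- Its anchor tolerance is `w = N E_tot + 1`. [folklore] -/
theorem Tb_w : (Tb hsf h2).w = Ngrid x.length * (Gx hsf h2).Etot (s0 x.length) (Tdbl x.length) (2 * Mfin x.length) + 1 := rfl
/-- Its blur radius is `e = N E_tot`. [folklore] -/
theorem Tb_e : (Tb hsf h2).e = Ngrid x.length * (Gx hsf h2).Etot (s0 x.length) (Tdbl x.length) (2 * Mfin x.length) := rfl
/-- Its number of ideals per period is `p`. [folklore] -/
theorem Tb_n : (Tb hsf h2).n = periodLength (DOf x) := rfl

/-- `1 ≤ w ≤ 3`, `0 ≤ e ≤ 2`. [folklore] -/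
theorem Tb_w_bounds : 1 ≤ (Tb hsf h2).w ∧ (Tb hsf h2).w ≤ 3 ∧ 0 ≤ (Tb hsf h2).e ∧ (Tb hsf h2).e ≤ 2 := by
  rw [Tb_w, Tb_e]
  have h := (Etot_small hsf h2).1
  have hE0 : 0 ≤ (Ngrid x.length : ℝ) * (Gx hsf h2).Etot (s0 x.length) (Tdbl x.length) (2 * Mfin x.length) := by
    have := (Tb hsf h2).e_nonneg; rw [Tb_e] at this; exact this
  refine ⟨by linarith, by linarith, hE0, h⟩

/-- On `[0, Q)` the blurred table is the walk table read by the quantum core. [folklore] -/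
theorem Tb_FN_eq {v : ℕ} (hv : v < 2 ^ LQ x.length) :
    (Tb hsf h2).FN v = (Wx x).table (Ngrid x.length) (s0 x.length) (Tdbl x.length) (2 * Mfin x.length) (v : ℤ) := by
  have hv0 : (0 : ℤ) ≤ (v : ℤ) := Int.natCast_nonneg v
  have hvV : (v : ℤ) ≤ (((2 ^ LQ x.length - 1 : ℕ)) : ℤ) := by
    have : v ≤ 2 ^ LQ x.length - 1 := by omega
    exact_mod_cast this
  have h := (Gx hsf h2).blurred_F_of_mem (Ngrid_pos _) (hV_range hsf h2) (Res_lt_M hsf h2) hv0 hvV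
  exact h

/-- **The autocorrelation mass of the coded table is that of the blurred table** (for any
`DecidableEq` instance on the blurred table's values: `HallgrenCombCorrMass.lean` states its
estimates with the classical one). [folklore] -/
theorem corrMass_tab_eq {i : DecidableEq (QuadIrr (DOf x) × ℤ)} (c : ℤ) :
    corrMass (2 ^ LQ x.length) (fun v : ℕ => tab x v) c = @corrMass _ i (2 ^ LQ x.length) (Tb hsf h2).FN c := by
  refine @PeriodFinding.corrMass_congr_rel _ _ _ i _ _ _ (fun v hv v' hv' => ?_) c
  rw [tab_eq_tab_iff, Tb_FN_eq hsf h2 hv, Tb_FN_eq hsf h2 hv']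

/-- The number of small harmonics tried: `Kh = ⌊S / 210⌋`. [cite: Jozsa2003, §10 (proof of Thm. 6: 0 ≤ k ≤ S/log S)] -/
def Kh : ℕ := ⌊Ngrid x.length * (Gx hsf h2).R / 210⌋₊

/-- The `k`-th harmonic character `⌊kQ/S⌉`. [cite: Jozsa2003, §10 (j = ⌊kq/S⌉)] -/
def ck (k : ℕ) : ℕ := (round ((k : ℝ) * (2 : ℝ) ^ LQ x.length / (Ngrid x.length * (Gx hsf h2).R))).toNat

/-- `S/220 ≤ Kh ≤ S/210`. [folklore] -/
theorem Kh_bounds : Ngrid x.length * (Gx hsf h2).R / 220 ≤ (Kh hsf h2 : ℝ) ∧ (Kh hsf h2 : ℝ) ≤ Ngrid x.length * (Gx hsf h2).R / 210 := by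
  have hS := S_ge hsf h2
  have hS0 : 0 ≤ Ngrid x.length * (Gx hsf h2).R / 210 := by positivity
  constructor
  · have := Nat.lt_floor_add_one (Ngrid x.length * (Gx hsf h2).R / 210)
    unfold Kh; linarith
  · exact Nat.floor_le hS0

/-- The harmonic character is the rounding, a natural number `< Q`, within `1/2` of `kQ/S`. [folklore] -/
theorem ck_spec {k : ℕ} (hk : k ∈ Icc 1 (Kh hsf h2)) :
    ((ck hsf h2 k : ℕ) : ℝ) = round ((k : ℝ) * (2 : ℝ) ^ LQ x.length / (Ngrid x.length * (Gx hsf h2).R)) ∧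
      ck hsf h2 k < 2 ^ LQ x.length ∧
      |((ck hsf h2 k : ℕ) : ℝ) - k * (2 : ℝ) ^ LQ x.length / (Ngrid x.length * (Gx hsf h2).R)| ≤ 1 / 2 := by
  rw [mem_Icc] at hk
  have hS := S_ge hsf h2
  have hKh := (Kh_bounds hsf h2).2
  set S := Ngrid x.length * (Gx hsf h2).R with hSdef
  set Q : ℝ := (2 : ℝ) ^ LQ x.length with hQ
  have hQ0 : 0 < Q := by positivity
  set t : ℝ := (k : ℝ) * Q / S with ht
  have ht0 : 0 ≤ t := by positivity
  have hS0 : (0 : ℝ) < S := by linarith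
  have htQ : t ≤ Q / 210 := by
    have hk' : (k : ℝ) ≤ Kh hsf h2 := by exact_mod_cast hk.2
    have hkS : (k : ℝ) ≤ S / 210 := hk'.trans hKh
    calc t = (k : ℝ) * Q / S := ht
      _ ≤ (S / 210) * Q / S := by
          apply div_le_div_of_nonneg_right _ hS0.le
          exact mul_le_mul_of_nonneg_right hkS hQ0.le
      _ = Q / 210 := by field_simp
  have hr := abs_sub_round t
  have hr0 : 0 ≤ round t := by
    have : (-1 : ℝ) < round t := by rw [abs_le] at hr; linarith
    exact_mod_cast (show (-1 : ℤ) < round t by exact_mod_cast this)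
  have hcast : ((ck hsf h2 k : ℕ) : ℝ) = round t := by
    unfold ck; rw [← ht]
    have : (((round t).toNat : ℕ) : ℤ) = round t := Int.toNat_of_nonneg hr0
    exact_mod_cast this
  refine ⟨hcast, ?_, by rw [hcast]; rw [abs_sub_comm] at hr; exact hr⟩
  have hQ1 : (1 : ℝ) ≤ Q := by rw [hQ]; exact one_le_pow₀ (by norm_num)
  have hlt : (round t : ℝ) < Q := by rw [abs_le] at hr; linarith
  rw [← hcast, hQ] at hlt
  exact_mod_cast hlt

/-- The harmonic characters are strictly increasing in `k` (as `Q/S ≥ 1`), hence injective on `[1, Kh]`. [folklore] -/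
theorem ck_injOn : Set.InjOn (ck hsf h2) (Icc 1 (Kh hsf h2) : Finset ℕ) := by
  have hQS : 1 ≤ (2 : ℝ) ^ LQ x.length / (Ngrid x.length * (Gx hsf h2).R) := by
    have hS := S_ge hsf h2
    have hQ := three_S_sq_le_Q hsf h2
    rw [le_div_iff₀ (by linarith)]; nlinarith
  have hmono : ∀ k k' : ℕ, k ∈ (Icc 1 (Kh hsf h2) : Finset ℕ) → k' ∈ (Icc 1 (Kh hsf h2) : Finset ℕ) → k < k' → ck hsf h2 k < ck hsf h2 k' := by
    intro k k' hk hk' hlt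
    have h1 := (ck_spec hsf h2 hk).1
    have h2' := (ck_spec hsf h2 hk').1
    set c := (2 : ℝ) ^ LQ x.length / (Ngrid x.length * (Gx hsf h2).R)
    have e1 : (k : ℝ) * (2 : ℝ) ^ LQ x.length / (Ngrid x.length * (Gx hsf h2).R) = k * c := by ring
    have e2 : (k' : ℝ) * (2 : ℝ) ^ LQ x.length / (Ngrid x.length * (Gx hsf h2).R) = k' * c := by ring
    rw [e1] at h1; rw [e2] at h2'
    have hkk : (k : ℝ) + 1 ≤ k' := by exact_mod_cast hlt
    have hgap : (k : ℝ) * c + 1 ≤ k' * c := by nlinarith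
    have hround : round ((k : ℝ) * c) < round ((k' : ℝ) * c) := by
      have a1 := abs_sub_round ((k : ℝ) * c)
      have a2 := abs_sub_round ((k' : ℝ) * c)
      rw [abs_le] at a1 a2
      by_contra hle
      push Not at hle
      have : (round ((k' : ℝ) * c) : ℝ) ≤ round ((k : ℝ) * c) := by exact_mod_cast hle
      -- `k'c − 1/2 ≤ round(k'c) ≤ round(kc) ≤ kc + 1/2 ≤ k'c − 1/2`: forces equalities, then round(k'c) = k'c − 1/2 and round(kc) = kc + 1/2 with kc + 1 = k'c; but then round(kc) = round(k'c) - 0 … contradiction with `round_le`? use half-integers: round (m + 1/2) = m + 1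
      have hkc : (k' : ℝ) * c = k * c + 1 := by linarith
      have hr1 : (round ((k : ℝ) * c) : ℝ) = k * c + 1 / 2 := by linarith
      have hr2 : (round ((k' : ℝ) * c) : ℝ) = k * c + 1 / 2 := by linarith
      have : round ((k' : ℝ) * c) = round ((k : ℝ) * c) + 1 := by
        rw [hkc, round_add_one]
      have : (round ((k' : ℝ) * c) : ℝ) = round ((k : ℝ) * c) + 1 := by exact_mod_cast this
      linarith
    have : ((ck hsf h2 k : ℕ) : ℝ) < ck hsf h2 k' := by rw [h1, h2']; exact_mod_cast hround
    exact_mod_cast this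
  intro k hk k' hk' h
  by_contra hne
  rcases lt_or_gt_of_ne hne with hlt | hlt
  · exact absurd h (ne_of_lt (hmono k k' hk hk' hlt))
  · exact absurd h.symm (ne_of_lt (hmono k' k hk' hk hlt))

/-- **At least `S/4` good starts.** [cite: Jozsa2003, §10 Prop. 36 (iii)] -/
theorem card_goodStarts_ge_quarter : Ngrid x.length * (Gx hsf h2).R / 4 ≤ ((Tb hsf h2).goodStarts.card : ℝ) := by
  have hS := S_ge hsf h2
  obtain ⟨hw1, hw3, he0, he2⟩ := Tb_w_bounds hsf h2
  have hgood := (Tb hsf h2).card_goodStarts_ge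
  have hTS : (Tb hsf h2).S = Ngrid x.length * (Gx hsf h2).R := rfl
  have hB1 : (Tb hsf h2).S - 2 * (Tb hsf h2).w - 1 ≤ ((Tb hsf h2).B : ℝ) := by
    have := Nat.lt_floor_add_one ((Tb hsf h2).S - 2 * (Tb hsf h2).w)
    unfold BlurredGapTable.B; linarith
  have hB2 : ((Tb hsf h2).B : ℝ) ≤ (Tb hsf h2).S := by
    have h0 : 0 ≤ (Tb hsf h2).S - 2 * (Tb hsf h2).w := by rw [hTS]; linarith
    have := Nat.floor_le h0
    unfold BlurredGapTable.B; linarith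
  have hn : ((Tb hsf h2).n : ℝ) ≤ 3 * (DOf x : ℝ) := by
    rw [Tb_n]; exact_mod_cast periodLength_le_three_mul (not_isSquare_DOf hsf h2) (DOf_mod_four x)
  -- `7 + 153 D ≤ 3S/4` from `S ≥ N/3`, `N = 2^{2n+12} = 64 P²`, `D + 1 ≤ P = 2^{n+3}`, `P ≥ 16`
  have hSbig : (7 : ℝ) + 153 * (DOf x : ℝ) ≤ 3 * (Ngrid x.length * (Gx hsf h2).R) / 4 := by
    have hn1 := one_le_length hsf h2
    have hR := R_gt hsf h2
    have hD : ((DOf x : ℕ) : ℝ) + 1 ≤ 2 ^ (x.length + 3) := by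
      have : (DOf x : ℕ) + 1 ≤ 2 ^ (x.length + 3) := DOf_lt x
      exact_mod_cast this
    have hN : (Ngrid x.length : ℝ) = 64 * (2 ^ (x.length + 3) * 2 ^ (x.length + 3)) := by
      rw [Ngrid_real, aN, ← pow_add, show 2 * x.length + 12 = 6 + ((x.length + 3) + (x.length + 3)) by ring, pow_add]
      norm_num
    have h16 : (16 : ℝ) ≤ 2 ^ (x.length + 3) := by
      calc (16 : ℝ) = 2 ^ 4 := by norm_num
        _ ≤ 2 ^ (x.length + 3) := pow_le_pow_right₀ (by norm_num) (by omega)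
    generalize hP : (2 : ℝ) ^ (x.length + 3) = P at hD hN h16
    -- `7 + 153 D ≤ 153 P − 146 ≤ 16 P² ≤ (3/4)(64 P²/3)`
    have hA : (7 : ℝ) + 153 * (DOf x : ℝ) ≤ 153 * P - 146 := by linarith
    have hB : (153 : ℝ) * P - 146 ≤ 16 * (P * P) := by nlinarith
    have hC : (64 : ℝ) * (P * P) * (1 / 3) ≤ Ngrid x.length * (Gx hsf h2).R := by
      rw [hN]; exact mul_le_mul_of_nonneg_left hR.le (by positivity)
    linarith
  have hS0 : 0 < (Tb hsf h2).S := by rw [hTS]; linarith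
  have hfrac : (((Tb hsf h2).B : ℝ) + 2 * (2 * (Tb hsf h2).w + (Tb hsf h2).e)) / (Tb hsf h2).S + 1 ≤ 3 := by
    rw [div_add_one hS0.ne', div_le_iff₀ hS0]; nlinarith
  have hB0 : (0 : ℝ) ≤ ((Tb hsf h2).B : ℝ) := Nat.cast_nonneg _
  have hf0 : (0 : ℝ) ≤ (((Tb hsf h2).B : ℝ) + 2 * (2 * (Tb hsf h2).w + (Tb hsf h2).e)) / (Tb hsf h2).S + 1 :=
    add_nonneg (div_nonneg (by linarith) hS0.le) zero_le_one
  have hμ : 2 * (2 * (Tb hsf h2).w + (Tb hsf h2).e) + 1 ≤ 17 := by linarith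
  have hμ0 : (0 : ℝ) ≤ 2 * (2 * (Tb hsf h2).w + (Tb hsf h2).e) + 1 := by linarith
  have hn0 : (0 : ℝ) ≤ (Tb hsf h2).n := Nat.cast_nonneg _
  have hprod : ((Tb hsf h2).n : ℝ) * ((((Tb hsf h2).B : ℝ) + 2 * (2 * (Tb hsf h2).w + (Tb hsf h2).e)) / (Tb hsf h2).S + 1) *
      (2 * (2 * (Tb hsf h2).w + (Tb hsf h2).e) + 1) ≤ 3 * (DOf x : ℝ) * 3 * 17 := by
    have := mul_le_mul (mul_le_mul hn hfrac hf0 (by positivity)) hμ hμ0 (by positivity)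
    linarith
  rw [hTS] at hB1
  linarith

/-- **At least `Q/(2S)` teeth.** [folklore] -/
theorem teeth_ge : (2 : ℝ) ^ LQ x.length / (2 * (Ngrid x.length * (Gx hsf h2).R)) ≤
    (((⌊((2 ^ LQ x.length : ℕ) : ℝ) / (Tb hsf h2).S⌋₊ - 1 : ℕ)) : ℝ) := by
  have hS := S_ge hsf h2
  have hQ3 := three_S_sq_le_Q hsf h2
  have hTS : (Tb hsf h2).S = Ngrid x.length * (Gx hsf h2).R := rfl
  have hQnat : ((2 ^ LQ x.length : ℕ) : ℝ) = (2 : ℝ) ^ LQ x.length := by push_cast; ring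
  rw [hTS, hQnat]
  generalize hSv : Ngrid x.length * (Gx hsf h2).R = S at hS hQ3
  generalize hQv : (2 : ℝ) ^ LQ x.length = Q at hQ3
  have hS0 : 0 < S := by linarith
  have hSne : S ≠ 0 := ne_of_gt hS0
  have hQS : 4 ≤ Q / S := by rw [le_div_iff₀ hS0]; nlinarith
  have hfl := Nat.lt_floor_add_one (Q / S)
  have hfl1 : 1 ≤ ⌊Q / S⌋₊ := (Nat.one_le_floor_iff _).2 (by linarith)
  rw [Nat.cast_sub hfl1, Nat.cast_one, div_le_iff₀ (by linarith)]
  have e : Q / S * (2 * S) = 2 * Q := by field_simp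
  nlinarith

omit hsf h2 in
/-- The arithmetic of the mass bound: `Q²/(2304 S) ≤ G (Tt/12)²` for `G ≥ S/4`, `Tt ≥ Q/(2S)`. [folklore] -/
theorem mass_arith {S Q G Tt : ℝ} (hS : 5000 ≤ S) (hcard : S / 4 ≤ G) (hteeth : Q / (2 * S) ≤ Tt) (hQ : 0 ≤ Q) :
    Q ^ 2 / (2304 * S) ≤ G * (Tt / 12) ^ 2 := by
  have hS0 : 0 < S := by linarith
  have hSne : S ≠ 0 := ne_of_gt hS0
  have hteeth0 : 0 ≤ Q / (2 * S) := div_nonneg hQ (by linarith)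
  have e : Q ^ 2 / (2304 * S) = (S / 4) * ((Q / (2 * S)) / 12) ^ 2 := by
    field_simp; ring
  rw [e]
  apply mul_le_mul hcard _ (by positivity) (by linarith)
  apply pow_le_pow_left₀ (div_nonneg hteeth0 (by norm_num))
  exact div_le_div_of_nonneg_right hteeth (by norm_num)

/-- **Every small harmonic is a heavy character of the walk table**:
`corrMass Q (tab x) (ck k) ≥ Q² / (2304 S)` for `1 ≤ k ≤ Kh`. [cite: Jozsa2003, §10 Thm. 6 (proof: prob(j) ≥ c/S) with Lemma 3] -/
theorem corrMass_ck_ge {k : ℕ} (hk : k ∈ Icc 1 (Kh hsf h2)) :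
    ((2 : ℝ) ^ LQ x.length) ^ 2 / (2304 * (Ngrid x.length * (Gx hsf h2).R)) ≤
      corrMass (2 ^ LQ x.length) (fun v : ℕ => tab x v) (ck hsf h2 k) := by
  have hS := S_ge hsf h2
  have hQ3 := three_S_sq_le_Q hsf h2
  obtain ⟨hw1, hw3, he0, he2⟩ := Tb_w_bounds hsf h2
  obtain ⟨hcr, hcQ, hc⟩ := ck_spec hsf h2 hk
  rw [mem_Icc] at hk
  have hKh := (Kh_bounds hsf h2).2
  have hTS : (Tb hsf h2).S = Ngrid x.length * (Gx hsf h2).R := rfl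
  have hQnat : ((2 ^ LQ x.length : ℕ) : ℝ) = (2 : ℝ) ^ LQ x.length := by push_cast; ring
  have hk' : (k : ℝ) ≤ Kh hsf h2 := by exact_mod_cast hk.2
  have hk0 : (0 : ℝ) ≤ k := Nat.cast_nonneg _
  -- the side conditions of Jozsa's estimate, from small contexts
  have hSS : (25000000 : ℝ) ≤ (Ngrid x.length * (Gx hsf h2).R) ^ 2 := by nlinarith only [hS]
  have hQbig : (75000000 : ℝ) ≤ (2 : ℝ) ^ LQ x.length := by linarith only [hQ3, hSS]
  have c1 : 1 ≤ (Tb hsf h2).S := by rw [hTS]; linarith only [hS]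
  have c2 : 100 * (2 * (Tb hsf h2).w + 1) ≤ ((2 ^ LQ x.length : ℕ) : ℝ) := by
    rw [hQnat]; linarith only [hQbig, hw3]
  have c3 : 5 * (Tb hsf h2).S + 5 * (2 * (Tb hsf h2).w + 1) ≤ ((2 ^ LQ x.length : ℕ) : ℝ) := by
    rw [hTS, hQnat]; nlinarith only [hS, hQ3, hw3]
  have c4 : 30 * (k : ℝ) * (2 * (Tb hsf h2).w + 1) ≤ (Tb hsf h2).S := by
    rw [hTS]
    have : 30 * (k : ℝ) * (2 * (Tb hsf h2).w + 1) ≤ 30 * (k : ℝ) * 7 := by nlinarith only [hk0, hw3]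
    nlinarith only [this, hk', hKh]
  have c5 : |(((ck hsf h2 k : ℕ) : ℤ) : ℝ) - k * ((2 ^ LQ x.length : ℕ) : ℝ) / (Tb hsf h2).S| ≤ 1 / 2 := by
    rw [hTS, hQnat]; push_cast; exact hc
  have hmain := (Tb hsf h2).corrMass_harmonic_ge c1 c2 c3 c4 c5
  have hcard := card_goodStarts_ge_quarter hsf h2
  have hteeth := teeth_ge hsf h2
  have harith := mass_arith hS hcard hteeth (pow_nonneg (by norm_num) _)
  -- `corrMass_harmonic_ge` is stated with the classical `DecidableEq` instance (its file opens
  -- `Classical`); `corrMass_tab_eq` is generic in that instance, so unification picks it up.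
  exact le_trans harith (le_trans hmain (le_of_eq (corrMass_tab_eq hsf h2 _).symm))

/-! #### The per-unit law -/

omit hsf h2 in
/-- The accuracy defect of a unit is exactly `1/2` (`B = 256 Lv`). [cite: Kitaev1995, §3 (before Lemma 9)] -/
theorem etaacc_eq (n : ℕ) : ηacc (LvQ n) (Brep n) = 1 / 2 := by
  unfold ηacc Brep LvQ LQ
  push_cast
  have h : (0 : ℝ) < (8 * (n : ℝ) + 42 + 1) := by positivity
  field_simp
  ring

/-- The unit type of the read-out law of the input. [folklore] -/
abbrev Ux : Type := Fin (hallgrenSS.nU x.length)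

/-- The units' block lengths (all `L`). [folklore] -/
abbrev Lux : Ux (x := x) → ℕ := fun _ => hallgrenSS.L x.length

/-- The units' tables (all the input's table). [folklore] -/
abbrev Fx : Ux (x := x) → ℕ → List Bool := fun _ v => tab x v

omit hsf h2 in
/-- The modulus of every unit is `Q = 2^L`. [folklore] -/
theorem Qof_Lux (u : Ux (x := x)) : Qof (Lux (x := x)) u = 2 ^ LQ x.length := rfl

/-- **The weight of a small harmonic in a unit is `≥ 1/(2304 S)`.** [cite: Jozsa2003, §10 Thm. 6 (proof)] -/
theorem unitWeight_ck_ge (u : Ux (x := x)) {k : ℕ} (hk : k ∈ Icc 1 (Kh hsf h2)) :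
    1 / (2304 * (Ngrid x.length * (Gx hsf h2).R)) ≤ unitWeight (Lux (x := x)) (Fx (x := x)) u (ck hsf h2 k) := by
  have hS := S_ge hsf h2
  have h := corrMass_ck_ge hsf h2 hk
  unfold unitWeight
  rw [Qof_Lux]
  have hq : (((2 ^ LQ x.length : ℕ)) : ℝ) = (2 : ℝ) ^ LQ x.length := by push_cast; ring
  rw [hq, le_div_iff₀ (pow_pos (pow_pos (by norm_num) _) 2)]
  have e : 1 / (2304 * (Ngrid x.length * (Gx hsf h2).R)) * ((2 : ℝ) ^ LQ x.length) ^ 2 =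
      ((2 : ℝ) ^ LQ x.length) ^ 2 / (2304 * (Ngrid x.length * (Gx hsf h2).R)) := by ring
  rw [e]
  exact h

/-- **Each unit reads each small harmonic with probability `≥ 1/(4608 S)`.**
[cite: Jozsa2003, §10 Thm. 6 (proof)] [cite: Kitaev1995, §3 Thm 1] -/
theorem prob_unit_ge (u : Ux (x := x)) {k : ℕ} (hk : k ∈ Icc 1 (Kh hsf h2)) :
    1 / (4608 * (Ngrid x.length * (Gx hsf h2).R)) ≤
      prob (X := fun _ : Ux (x := x) => TIdx (LvQ x.length) (Brep x.length) → Bool)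
        (unitLaw (Lux (x := x)) (Fx (x := x)))
        (univ.filter fun γ => cEst (Qof (Lux (x := x)) u) (γ u) = ck hsf h2 k) := by
  have hcQ' : ck hsf h2 k < Qof (Lux (x := x)) u := by rw [Qof_Lux]; exact (ck_spec hsf h2 hk).2.1
  have hB : 0 < Brep x.length := by unfold Brep; omega
  have hLv : 0 < LvQ x.length := by unfold LvQ; omega
  have hQLv : Qof (Lux (x := x)) u ≤ 2 ^ (LvQ x.length - 1) := by
    rw [Qof_Lux]; unfold LvQ; simp
  have h := prob_cEst_ge (Lux (x := x)) (Fx (x := x)) hB hLv hQLv ⟨ck hsf h2 k, hcQ'⟩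
  have hw := unitWeight_ck_ge hsf h2 u hk
  have hacc : ηacc (LvQ x.length) (Brep x.length) = 1 / 2 := etaacc_eq x.length
  rw [hacc] at h
  have e : (1 : ℝ) / (4608 * (Ngrid x.length * (Gx hsf h2).R)) = (1 - 1 / 2) * (1 / (2304 * (Ngrid x.length * (Gx hsf h2).R))) := by
    ring
  rw [e]
  exact le_trans (mul_le_mul_of_nonneg_left hw (by norm_num)) h

/-! #### Two units, and the `2^41` pairs -/

omit hsf h2 in
/-- `NPAIRS = 2^41` pairs fit in the `2^42` units. [folklore] -/
theorem two_mul_lt_of_lt_NPAIRS {i : ℕ} (h : i < NPAIRS) : 2 * i + 1 < 2 ^ 44 := by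
  rw [NPAIRS_def] at h; omega

/-- The first unit of pair `i`. [folklore] -/
def ua (i : Fin NPAIRS) : Ux (x := x) := ⟨2 * i, by show 2 * i.val < 2 ^ 44; have := two_mul_lt_of_lt_NPAIRS i.isLt; omega⟩
/-- The second unit of pair `i`. [folklore] -/
def ub (i : Fin NPAIRS) : Ux (x := x) := ⟨2 * i + 1, by show 2 * i.val + 1 < 2 ^ 44; exact two_mul_lt_of_lt_NPAIRS i.isLt⟩

omit hsf h2 in
/-- The pairs are disjoint. [folklore] -/
theorem disjointPairs : DisjointPairs (ua (x := x)) (ub (x := x)) where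
  inj_a i j h := by have := congrArg Fin.val h; simp [ua] at this; exact Fin.ext this
  inj_b i j h := by have := congrArg Fin.val h; simp [ub] at this; exact Fin.ext this
  a_ne_b i j h := by have := congrArg Fin.val h; simp [ua, ub] at this; omega

/-- **The event of pair `i`**: its two units read a coprime pair of small harmonics
(the event of `prob_twoSamples_ge`). [cite: Jozsa2003, §10 (gcd(k,l) = 1)] -/
abbrev GoodPair (i : Fin NPAIRS) (γa γb : TIdx (LvQ x.length) (Brep x.length) → Bool) : Prop :=
  ∃ kk ∈ ((Icc 1 (Kh hsf h2)) ×ˢ (Icc 1 (Kh hsf h2))).filter (fun kl : ℕ × ℕ => Nat.Coprime kl.1 kl.2),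
    cEst (Qof (Lux (x := x)) (ua i)) γa = ck hsf h2 kk.1 ∧ cEst (Qof (Lux (x := x)) (ub i)) γb = ck hsf h2 kk.2

omit hsf h2 in
/-- The numerical bound behind a pair: `2^{−41} ≤ (K²/2) q²` for `K ≥ S/220`, `q = 1/(4608 S)`. [folklore] -/
theorem pair_const_le {S K : ℝ} (hS : 5000 ≤ S) (hK : S / 220 ≤ K) :
    (1 : ℝ) / 2 ^ 41 ≤ K ^ 2 / 2 * (1 / (4608 * S) * (1 / (4608 * S))) := by
  have hK0 : 0 ≤ S / 220 := by positivity
  have hK2 : (S / 220) ^ 2 ≤ K ^ 2 := pow_le_pow_left₀ hK0 hK 2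
  have hS0 : 0 < S := by linarith
  have hSne : S ≠ 0 := ne_of_gt hS0
  have h1 : (1 : ℝ) / 2 ^ 41 ≤ (S / 220) ^ 2 / 2 * (1 / (4608 * S) * (1 / (4608 * S))) := by
    have e : (S / 220) ^ 2 / 2 * (1 / (4608 * S) * (1 / (4608 * S))) = 1 / (220 ^ 2 * 2 * 4608 ^ 2) := by
      field_simp
    rw [e]; exact one_div_le_one_div_of_le (by positivity) (by norm_num)
  refine h1.trans (mul_le_mul_of_nonneg_right (by linarith) (by positivity))

/-- **A pair succeeds with probability `≥ 2^{−41}`.** [cite: Jozsa2003, §10 (proof of Thm. 6: two runs, gcd = 1)] -/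
theorem prob_pair_ge (i : Fin NPAIRS) :
    (1 : ℝ) / 2 ^ 41 ≤ prob (X := fun _ : Ux (x := x) => TIdx (LvQ x.length) (Brep x.length) → Bool)
      (unitLaw (Lux (x := x)) (Fx (x := x)))
      (univ.filter fun γ => GoodPair hsf h2 i (γ (ua i)) (γ (ub i))) := by
  have hS := S_ge hsf h2
  have hq0 : (0 : ℝ) ≤ 1 / (4608 * (Ngrid x.length * (Gx hsf h2).R)) := div_nonneg zero_le_one (by linarith)
  have h := prob_twoSamples_ge (Lv := LvQ x.length) (B := Brep x.length) (Lux (x := x)) (Fx (x := x))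
    (u := ua i) (u' := ub i) ((disjointPairs (x := x)).a_ne_b i i) (Kh hsf h2) (ck hsf h2) (ck hsf h2)
    (ck_injOn hsf h2) (ck_injOn hsf h2) hq0 hq0 (fun k hk => prob_unit_ge hsf h2 (ua i) hk) (fun k hk => prob_unit_ge hsf h2 (ub i) hk)
  exact le_trans (pair_const_le hS (Kh_bounds hsf h2).1) h

omit hsf h2 in
/-- `(1 − p)^m ≤ 1/(1 + m p)` for `0 ≤ p ≤ 1` (Bernoulli; as `GabberGalil.one_sub_pow_le` of
`Complexity/GabberGalil.lean`, not imported here — a private copy). [folklore] -/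
private theorem one_sub_pow_le {p : ℝ} (hp0 : 0 ≤ p) (hp1 : p ≤ 1) (m : ℕ) : (1 - p) ^ m ≤ 1 / (1 + m * p) := by
  have hB := one_add_mul_le_pow (show (-2 : ℝ) ≤ p by linarith) m
  have h1 : (1 + (m : ℝ) * p) * (1 - p) ^ m ≤ ((1 + p) * (1 - p)) ^ m := by
    rw [mul_pow]; exact mul_le_mul_of_nonneg_right hB (pow_nonneg (by linarith) m)
  have h2 : ((1 + p) * (1 - p)) ^ m ≤ 1 := pow_le_one₀ (by nlinarith) (by nlinarith)
  rw [le_div_iff₀ (by positivity)]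
  linarith [mul_comm ((1 - p) ^ m) (1 + (m : ℝ) * p)]

omit hsf h2 in
/-- `NPAIRS` as a real number. [folklore] -/
theorem NPAIRS_real : ((NPAIRS : ℕ) : ℝ) = 2 ^ 43 := by rw [NPAIRS_def]; norm_num

/-- **Some pair succeeds with probability `≥ 4/5`.** [cite: Jozsa2003, §10 (repetition boosts 1/poly to a constant)] -/
theorem prob_exists_goodPair_ge :
    (4 : ℝ) / 5 ≤ prob (X := fun _ : Ux (x := x) => TIdx (LvQ x.length) (Brep x.length) → Bool)
      (unitLaw (Lux (x := x)) (Fx (x := x)))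
      (univ.filter fun γ => ∃ i : Fin NPAIRS, GoodPair hsf h2 i (γ (ua i)) (γ (ub i))) := by
  have h := prob_exists_pair_ge (unitLaw_isProbVec (Lux (x := x)) (Fx (x := x))) (disjointPairs (x := x))
    (fun i γa γb => GoodPair hsf h2 i γa γb) univ (p := (1 : ℝ) / 2 ^ 41) (fun i _ => prob_pair_ge hsf h2 i)
  rw [card_univ, Fintype.card_fin] at h
  have hb := one_sub_pow_le (p := (1 : ℝ) / 2 ^ 41) (by positivity) (by rw [div_le_one (by positivity)]; norm_num) NPAIRS
  rw [NPAIRS_real] at hb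
  have h5 : (1 : ℝ) / (1 + (2 : ℝ) ^ 43 * (1 / 2 ^ 41)) = 1 / 5 := by norm_num
  rw [h5] at hb
  -- hide the huge power (irreducible exponent) from the arithmetic
  generalize ht : ((1 : ℝ) - 1 / 2 ^ 41) ^ NPAIRS = t at h hb
  have h45 : (4 : ℝ) / 5 ≤ 1 - t := by linarith
  refine le_trans h45 (le_trans h (le_of_eq (congrArg (prob (unitLaw (Lux (x := x)) (Fx (x := x)))) ?_)))
  ext γ
  simp only [mem_filter, mem_univ, true_and]

end Sampling
/-! ### Correctness of the post-processing on the success event -/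

section Post

variable {x : List Bool} (hsf : Squarefree (dOf x)) (h2 : 2 ≤ dOf x)
include hsf h2

/-- `Efin ≤ Etot`. [folklore] -/
theorem Efin_le_Etot : (Gx hsf h2).Efin (s0 x.length) (Tdbl x.length) (2 * Mfin x.length) ≤
    (Gx hsf h2).Etot (s0 x.length) (Tdbl x.length) (2 * Mfin x.length) := by
  unfold GiantStepCycle.Efin GiantStepCycle.Etot
  have := (Gx hsf h2).η_nonneg
  push_cast; nlinarith

/-- The probed state on integer pairs is the image of the cycle's probe. [folklore] -/
theorem probeZ_eq (m j : ℕ) : probeZ x m j =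
    WalkMap.mapSt toZ ((Gx hsf h2).probe (((m : ℤ) : ℚ) / (Ngrid x.length : ℚ)) ((4 : ℚ) / (Ngrid x.length : ℚ))
      (s0 x.length) (Tdbl x.length) (2 * Mfin x.length) j) := by
  unfold probeZ GiantStepCycle.probe
  have hx : (((m : ℤ) : ℚ) / (Ngrid x.length : ℚ)) - (4 : ℚ) / (Ngrid x.length : ℚ) = ((((m : ℤ) - 4 : ℤ)) : ℚ) / (Ngrid x.length : ℚ) := by
    push_cast; ring
  rw [hx]
  induction j with
  | zero =>
    simp only [Function.iterate_zero, id_eq]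
    exact (WalkMap.map_final (principalWalk (DOf x) (precP x.length)) (walkZ (DOf x) (precP x.length)) toZ rfl
      (fun a => by simp [principalWalk, walkZ]) (fun a b => by simp [principalWalk, walkZ]) (fun a => by simp [principalWalk, walkZ])
      (fun a b => by simp [principalWalk, walkZ]) rfl _ _ _ _).symm
  | succ j ih =>
    rw [Function.iterate_succ_apply', Function.iterate_succ_apply', ih]
    exact (WalkMap.map_babyStep (principalWalk (DOf x) (precP x.length)) (walkZ (DOf x) (precP x.length)) toZ
      (fun a => by simp [principalWalk, walkZ]) (fun a => by simp [principalWalk, walkZ]) _).symm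

/-- **The Boolean test is the cycle's `Passes`.** [cite: Jozsa2003, §10 (c)] -/
theorem passesB_eq_true_iff (m : ℕ) : passesB x m = true ↔
    (Gx hsf h2).Passes (((m : ℤ) : ℚ) / (Ngrid x.length : ℚ)) ((4 : ℚ) / (Ngrid x.length : ℚ)) (s0 x.length) (Tdbl x.length) (2 * Mfin x.length) := by
  have hchk : ∀ j, chkB x m j = true ↔ (Gx hsf h2).CheckAt (((m : ℤ) : ℚ) / (Ngrid x.length : ℚ)) ((4 : ℚ) / (Ngrid x.length : ℚ))
      (s0 x.length) (Tdbl x.length) (2 * Mfin x.length) j := by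
    intro j
    unfold chkB GiantStepCycle.CheckAt
    rw [probeZ_eq hsf h2, Bool.and_eq_true, decide_eq_true_iff, decide_eq_true_iff]
    simp only [WalkMap.mapSt]
    have hunit : (Gx hsf h2).unit = (⟨unitP (DOf x), 2⟩ : QuadIrr (DOf x)) := rfl
    rw [hunit]
    constructor
    · rintro ⟨h1, h2'⟩
      refine ⟨toZ_injective (by rw [h1]; rfl), ?_⟩
      push_cast at h2' ⊢
      convert h2' using 2; ring
    · rintro ⟨h1, h2'⟩
      refine ⟨by rw [h1]; rfl, ?_⟩
      push_cast at h2' ⊢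
      convert h2' using 2; ring
  unfold passesB GiantStepCycle.Passes
  rw [Bool.or_eq_true, Bool.or_eq_true, hchk, hchk, hchk]
  constructor
  · rintro (h | h | h)
    exacts [⟨0, by norm_num, h⟩, ⟨1, by norm_num, h⟩, ⟨2, le_rfl, h⟩]
  · rintro ⟨j, hj, h⟩
    interval_cases j
    exacts [Or.inl h, Or.inr (Or.inl h), Or.inr (Or.inr h)]

set_option maxHeartbeats 1000000 in
/-- **Soundness of acceptance**: an accepted candidate is within `10` of a positive multiple of `S`.
[cite: Jozsa2003, §10 (proof of Thm. 6, requirement (c))] -/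
theorem accB_sound {m : ℕ} (h : accB x m = true) :
    ∃ l : ℤ, 1 ≤ l ∧ |(m : ℝ) - l * (Ngrid x.length * (Gx hsf h2).R)| ≤ 10 := by
  unfold accB at h
  rw [Bool.and_eq_true, decide_eq_true_iff, passesB_eq_true_iff hsf h2] at h
  obtain ⟨h12, hP⟩ := h
  obtain ⟨l, hl, hl1⟩ := (Gx hsf h2).passes_sound hP
  have hE := Efin_le_Etot hsf h2
  have hEt := N_mul_Etot_le hsf h2
  have hN := Ngrid_ge x.length
  have hN0 : (0 : ℝ) < Ngrid x.length := by linarith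
  have hη0 := (Gx hsf h2).η_nonneg
  set E := (Gx hsf h2).Efin (s0 x.length) (Tdbl x.length) (2 * Mfin x.length)
  have hEN : (Ngrid x.length : ℝ) * (E + 2 * (Gx hsf h2).η) ≤ 2 := by nlinarith
  have hcastx : (((((m : ℤ) : ℚ) / (Ngrid x.length : ℚ)) : ℚ) : ℝ) = (m : ℝ) / Ngrid x.length := by push_cast; rfl
  have hcastΔ : ((((4 : ℚ) / (Ngrid x.length : ℚ)) : ℚ) : ℝ) = 4 / Ngrid x.length := by push_cast; rfl
  rw [hcastx, hcastΔ] at hl hl1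
  refine ⟨l, hl1 ?_, ?_⟩
  · -- `8/N + E + 2η ≤ 10/N < 12/N ≤ m/N`
    have hm : (12 : ℝ) ≤ m := by exact_mod_cast h12
    rw [lt_div_iff₀ hN0]
    have e : (2 * (4 / (Ngrid x.length : ℝ)) + E + 2 * (Gx hsf h2).η) * Ngrid x.length = 8 + Ngrid x.length * (E + 2 * (Gx hsf h2).η) := by
      field_simp; ring
    rw [e]; linarith
  · have hmul : |(m : ℝ) - l * (Ngrid x.length * (Gx hsf h2).R)| = Ngrid x.length * |(m : ℝ) / Ngrid x.length - l * (Gx hsf h2).R| := by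
      rw [← abs_of_pos hN0, ← abs_mul, abs_of_pos hN0]; congr 1; field_simp
    rw [hmul]
    calc (Ngrid x.length : ℝ) * |(m : ℝ) / Ngrid x.length - l * (Gx hsf h2).R|
        ≤ Ngrid x.length * (2 * (4 / Ngrid x.length) + E + 2 * (Gx hsf h2).η) := mul_le_mul_of_nonneg_left hl hN0.le
      _ = 8 + Ngrid x.length * (E + 2 * (Gx hsf h2).η) := by field_simp; ring
      _ ≤ 10 := by linarith

set_option maxHeartbeats 1000000 in
/-- **Completeness of acceptance**: a candidate within `1` of `S` is accepted.
[cite: Jozsa2003, §10 (proof of Thm. 6, requirement (c)) with §9 Thm. 5] -/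
theorem accB_complete {m : ℕ} (hm : |(Ngrid x.length * (Gx hsf h2).R) - m| < 1) : accB x m = true := by
  have hS := S_ge hsf h2
  have hN := Ngrid_ge x.length
  have hN0 : (0 : ℝ) < Ngrid x.length := by linarith
  have hm12 : 12 ≤ m := by
    have : (11 : ℝ) < m := by rw [abs_lt] at hm; linarith
    exact_mod_cast (show (11 : ℕ) < m by exact_mod_cast this)
  unfold accB
  rw [Bool.and_eq_true, decide_eq_true_iff, passesB_eq_true_iff hsf h2]
  refine ⟨hm12, ?_⟩
  have hE := Efin_le_Etot hsf h2
  have hEt := N_mul_Etot_le hsf h2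
  have hη0 := (Gx hsf h2).η_nonneg
  have hη8 := (Gx hsf h2).η_le
  set E := (Gx hsf h2).Efin (s0 x.length) (Tdbl x.length) (2 * Mfin x.length)
  have hEN : (Ngrid x.length : ℝ) * (E + 2 * (Gx hsf h2).η) ≤ 2 := by nlinarith
  have hE0 : 0 ≤ E := by
    show 0 ≤ (Gx hsf h2).Efin _ _ _
    unfold GiantStepCycle.Efin; have := (Gx hsf h2).Edesc_nonneg (s0 x.length) (Tdbl x.length) 0; positivity
  refine (Gx hsf h2).passes_complete (s0 x.length) (l := 1) (δ := 1 / Ngrid x.length) ?_ ?_ (Res_lt_M hsf h2) ?_ ?_ ?_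
  · -- `4/N ≤ m/N`
    have : (4 : ℚ) ≤ ((m : ℤ) : ℚ) := by exact_mod_cast (show (4 : ℤ) ≤ m by exact_mod_cast (by omega : 4 ≤ m))
    exact div_le_div_of_nonneg_right this (by positivity)
  · -- the target `(m − 4)/N ≤ (S + 1)/N ≤ Q/N` is within the doubling range
    refine le_dbl hsf h2 ?_
    rw [← Q_div_N x]
    have hcast : ((((((m : ℤ) : ℚ) / (Ngrid x.length : ℚ)) - (4 : ℚ) / (Ngrid x.length : ℚ) : ℚ)) : ℝ) = ((m : ℝ) - 4) / Ngrid x.length := by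
      push_cast; ring
    rw [hcast]
    apply div_le_div_of_nonneg_right _ hN0.le
    have hQ := three_S_sq_le_Q hsf h2
    rw [abs_lt] at hm
    nlinarith
  · -- `|m/N − R| ≤ 1/N`
    have hcastx : (((((m : ℤ) : ℚ) / (Ngrid x.length : ℚ)) : ℚ) : ℝ) = (m : ℝ) / Ngrid x.length := by push_cast; rfl
    rw [hcastx, Int.cast_one, one_mul]
    have : |(m : ℝ) / Ngrid x.length - (Gx hsf h2).R| = |(Ngrid x.length * (Gx hsf h2).R) - m| / Ngrid x.length := by
      rw [abs_sub_comm, ← abs_of_pos hN0, ← abs_div, abs_of_pos hN0]; congr 1; field_simp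
    rw [this]
    exact div_le_div_of_nonneg_right hm.le hN0.le
  · -- `1/N + E + 2η < 4/N`
    have hcastΔ : ((((4 : ℚ) / (Ngrid x.length : ℚ)) : ℚ) : ℝ) = 4 / Ngrid x.length := by push_cast; rfl
    rw [hcastΔ]
    have h2N : E + 2 * (Gx hsf h2).η ≤ 2 / Ngrid x.length := by
      rw [le_div_iff₀ hN0]; linarith [mul_comm (Ngrid x.length : ℝ) (E + 2 * (Gx hsf h2).η)]
    have h34 : (1 : ℝ) / Ngrid x.length + 2 / Ngrid x.length < 4 / Ngrid x.length := by
      rw [← add_div]; exact div_lt_div_of_pos_right (by norm_num) hN0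
    linarith
  · -- `4/N + E + η + 1/N < ln 2`
    have hcastΔ : ((((4 : ℚ) / (Ngrid x.length : ℚ)) : ℚ) : ℝ) = 4 / Ngrid x.length := by push_cast; rfl
    rw [hcastΔ, GL_eq]
    have hl2 := Real.log_two_gt_d9
    have h5 : (4 : ℝ) / Ngrid x.length + 1 / Ngrid x.length ≤ 5 / 4096 := by
      rw [← add_div, show (4 : ℝ) + 1 = 5 by norm_num]
      exact div_le_div_of_nonneg_left (by norm_num) (by norm_num) hN
    have hE2 : E + (Gx hsf h2).η ≤ 2 / 4096 := by
      have : (Ngrid x.length : ℝ) * (E + (Gx hsf h2).η) ≤ 2 := by nlinarith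
      rw [le_div_iff₀ (by norm_num)]; nlinarith
    linarith

omit hsf h2 in
/-- Rounding of `m₀/N` when `|m₀ − N R| ≤ 10`, `N ≥ 21`: `⌊m₀/N⌉ ∈ {⌊R⌋, ⌈R⌉}`. [folklore] -/
theorem rdiv_mem {m₀ N : ℕ} {R : ℝ} (hR : 0 ≤ R) (hN : 21 ≤ N) (h : |(m₀ : ℝ) - N * R| ≤ 10) :
    rdiv m₀ N = ⌊R⌋₊ ∨ rdiv m₀ N = ⌈R⌉₊ := by
  have hN0 : (0 : ℝ) < N := by exact_mod_cast (show 0 < N by omega)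
  have hround := rdiv_eq_round (a := m₀) (c := N) (by omega)
  have hclose : |(m₀ : ℝ) / N - R| < 1 / 2 := by
    have : |(m₀ : ℝ) / N - R| = |(m₀ : ℝ) - N * R| / N := by
      rw [← abs_of_pos hN0, ← abs_div, abs_of_pos hN0]; congr 1; field_simp
    rw [this, div_lt_iff₀ hN0]
    have : (21 : ℝ) ≤ N := by exact_mod_cast hN
    nlinarith
  have h1 := abs_sub_round ((m₀ : ℝ) / N)
  have hlt : |(round ((m₀ : ℝ) / N) : ℝ) - R| < 1 := by
    have := abs_sub_le (round ((m₀ : ℝ) / N) : ℝ) ((m₀ : ℝ) / N) R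
    rw [abs_sub_comm] at h1; linarith
  rw [abs_lt] at hlt
  have hfl := Nat.floor_le hR
  have hfl2 := Nat.lt_floor_add_one R
  have hce := Nat.le_ceil R
  have hce2 := Nat.ceil_lt_add_one hR
  have hr : ((rdiv m₀ N : ℕ) : ℝ) = round ((m₀ : ℝ) / N) := by exact_mod_cast hround
  by_cases hle : ((rdiv m₀ N : ℕ) : ℝ) ≤ R
  · left
    have h3 : (⌊R⌋₊ : ℝ) - 1 < rdiv m₀ N := by rw [hr]; linarith
    have h4 : ((rdiv m₀ N : ℕ) : ℝ) < ⌊R⌋₊ + 1 := lt_of_le_of_lt hle hfl2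
    have h3' : (⌊R⌋₊ : ℤ) - 1 < (rdiv m₀ N : ℕ) := by exact_mod_cast h3
    have h4' : ((rdiv m₀ N : ℕ) : ℤ) < ⌊R⌋₊ + 1 := by exact_mod_cast h4
    omega
  · right
    push Not at hle
    have h3 : (⌈R⌉₊ : ℝ) - 1 < rdiv m₀ N := by linarith
    have h4 : ((rdiv m₀ N : ℕ) : ℝ) < ⌈R⌉₊ + 1 := by rw [hr]; linarith
    have h3' : (⌈R⌉₊ : ℤ) - 1 < (rdiv m₀ N : ℕ) := by exact_mod_cast h3
    have h4' : ((rdiv m₀ N : ℕ) : ℤ) < ⌈R⌉₊ + 1 := by exact_mod_cast h4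
    omega

/-- **A good candidate is listed and accepted** on the success event: Legendre's theorem gives a
convergent numerator `p` of `c/d` with `|S − ⌊pQ/c⌉| < 1`, and such a candidate passes the test.
[cite: Jozsa2003, §10 Thm. 6 (proof)] -/
theorem exists_good_cand {v : List Bool} {i : Fin NPAIRS}
    (hv : GoodPair hsf h2 i (hallgrenSS.readOf x.length v (ua i)) (hallgrenSS.readOf x.length v (ub i))) :
    ∃ m ∈ allCands x.length v, accB x m = true ∧ |Ngrid x.length * (Gx hsf h2).R - m| < 1 := by
  obtain ⟨kk, hkk, hca, hcb⟩ := hv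
  rw [mem_filter, mem_product] at hkk
  obtain ⟨⟨hk, hl⟩, hcop⟩ := hkk
  have hS := S_ge hsf h2
  have hQ3 := three_S_sq_le_Q hsf h2
  have hKh := (Kh_bounds hsf h2).2
  -- the characters of the pair
  have hc : hallgrenSS.charOf x.length v (2 * (i : ℕ)) = ck hsf h2 kk.1 :=
    (hallgrenSS.charOf_eq x.length v (ua i)).trans hca
  have hd : hallgrenSS.charOf x.length v (2 * (i : ℕ) + 1) = ck hsf h2 kk.2 :=
    (hallgrenSS.charOf_eq x.length v (ub i)).trans hcb
  obtain ⟨hc1, hcQ, hcr⟩ := ck_spec hsf h2 hk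
  obtain ⟨hd1, hdQ, hdr⟩ := ck_spec hsf h2 hl
  rw [mem_Icc] at hk hl
  have hk2 : (kk.1 : ℝ) ≤ Kh hsf h2 := by exact_mod_cast hk.2
  have hl2 : (kk.2 : ℝ) ≤ Kh hsf h2 := by exact_mod_cast hl.2
  have hkS : (kk.1 : ℝ) ≤ Ngrid x.length * (Gx hsf h2).R := by linarith only [hk2, hKh, hS]
  have hlS : (kk.2 : ℝ) ≤ Ngrid x.length * (Gx hsf h2).R := by linarith only [hl2, hKh, hS]
  -- Legendre: a convergent numerator hits `S` after rounding
  have hqnat : ((2 ^ LQ x.length : ℕ) : ℝ) = (2 : ℝ) ^ LQ x.length := by push_cast; ring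
  have hq3' : 3 * (Ngrid x.length * (Gx hsf h2).R) ^ 2 ≤ ((2 ^ LQ x.length : ℕ) : ℝ) := by rw [hqnat]; exact hQ3
  have hcr' : |(((ck hsf h2 kk.1 : ℕ) : ℤ) : ℝ) - kk.1 * ((2 ^ LQ x.length : ℕ) : ℝ) / (Ngrid x.length * (Gx hsf h2).R)| ≤ 1 / 2 := by
    push_cast; exact hcr
  have hdr' : |(((ck hsf h2 kk.2 : ℕ) : ℤ) : ℝ) - kk.2 * ((2 ^ LQ x.length : ℕ) : ℝ) / (Ngrid x.length * (Gx hsf h2).R)| ≤ 1 / 2 := by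
    push_cast; exact hdr
  have hdQ' : ((ck hsf h2 kk.2 : ℕ) : ℤ).toNat < 2 ^ LQ x.length := by rw [Int.toNat_natCast]; exact hdQ
  obtain ⟨p, hp, hpS⟩ := exists_mem_numsOf_round (by linarith only [hS]) hq3' hk.1 hkS hl.1 hlS hcop hcr' hdr' hdQ'
  rw [Int.toNat_natCast, Int.toNat_natCast] at hp
  -- the candidate `m* = ⌊pQ/c⌉`
  have hcpos : 0 < ck hsf h2 kk.1 := by
    have hk1 : (1 : ℝ) ≤ kk.1 := by exact_mod_cast hk.1
    have hS0 : 0 < Ngrid x.length * (Gx hsf h2).R := by linarith only [hS]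
    have h1 : (1 : ℝ) ≤ (kk.1 : ℝ) * (2 : ℝ) ^ LQ x.length / (Ngrid x.length * (Gx hsf h2).R) := by
      rw [le_div_iff₀ hS0]; nlinarith only [hk1, hQ3, hS]
    have : (0 : ℝ) < ck hsf h2 kk.1 := by rw [abs_le] at hcr; linarith only [hcr.1, h1]
    exact_mod_cast this
  refine ⟨rdiv (p * 2 ^ LQ x.length) (ck hsf h2 kk.1), ?_, ?_, ?_⟩
  · unfold allCands
    rw [List.mem_flatten]
    refine ⟨pairCands x.length v i, List.mem_map.2 ⟨i, List.mem_range.2 i.isLt, rfl⟩, ?_⟩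
    unfold pairCands
    rw [List.mem_map]
    exact ⟨p, by rw [hc, hd]; exact hp, by rw [hc]⟩
  · refine accB_complete hsf h2 ?_
    have hr : ((rdiv (p * 2 ^ LQ x.length) (ck hsf h2 kk.1) : ℕ) : ℝ) = round ((p : ℝ) * ((2 ^ LQ x.length : ℕ) : ℝ) / (((ck hsf h2 kk.1 : ℕ) : ℤ) : ℝ)) := by
      have := rdiv_eq_round (a := p * 2 ^ LQ x.length) hcpos
      push_cast at this ⊢
      exact_mod_cast this
    rw [hr]; exact hpS
  · have hr : ((rdiv (p * 2 ^ LQ x.length) (ck hsf h2 kk.1) : ℕ) : ℝ) = round ((p : ℝ) * ((2 ^ LQ x.length : ℕ) : ℝ) / (((ck hsf h2 kk.1 : ℕ) : ℤ) : ℝ)) := by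
      have := rdiv_eq_round (a := p * 2 ^ LQ x.length) hcpos
      push_cast at this ⊢
      exact_mod_cast this
    rw [hr]; exact hpS

omit hsf h2 in
/-- The selection picks an accepted candidate below any given accepted one. [folklore] -/
theorem sel_spec {ms : List ℕ} {m : ℕ} (hm : m ∈ ms) (hacc : accB x m = true) :
    ∃ m₀, sel x ms = (true, m₀) ∧ accB x m₀ = true ∧ m₀ ≤ m := by
  have hmem : m ∈ ms.filter (accB x) := List.mem_filter.2 ⟨hm, hacc⟩
  have hne : ms.filter (accB x) ≠ [] := List.ne_nil_of_mem hmem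
  obtain ⟨m₀, hm₀⟩ := Option.ne_none_iff_exists'.1 (fun h => hne (List.min?_eq_none_iff.1 h))
  refine ⟨m₀, by rw [sel, minAcc_eq, hm₀], (List.mem_filter.1 (List.min?_mem hm₀)).2, ?_⟩
  exact (List.le_min?_iff hm₀).1 le_rfl m hmem

/-- **On the success event the post-processor outputs `⌊R⌋` or `⌈R⌉`, self-delimited.**
[cite: Jozsa2003, §10 Thm. 6 (proof) and Thm. 7] -/
theorem post_correct {v : List Bool} (hv : ∃ i : Fin NPAIRS, GoodPair hsf h2 i (hallgrenSS.readOf x.length v (ua i)) (hallgrenSS.readOf x.length v (ub i))) :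
    ∃ r : ℕ, (r = ⌊(Gx hsf h2).R⌋₊ ∨ r = ⌈(Gx hsf h2).R⌉₊) ∧ post x v = boolPair (encodeNat r) [] := by
  obtain ⟨i, hi⟩ := hv
  obtain ⟨m, hmem, hacc, hclose⟩ := exists_good_cand hsf h2 hi
  obtain ⟨m₀, hsel, hacc₀, hle⟩ := sel_spec (x := x) hmem hacc
  obtain ⟨l, hl1, hl⟩ := accB_sound hsf h2 hacc₀
  have hS := S_ge hsf h2
  -- `l = 1`: `m₀ ≤ m < S + 1` and `m₀ ≥ l S − 10`
  have hl_eq : l = 1 := by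
    by_contra hne1
    have hl2 : (2 : ℝ) ≤ l := by exact_mod_cast (show (2 : ℤ) ≤ l by omega)
    have hm₀R : (m₀ : ℝ) ≤ m := by exact_mod_cast hle
    rw [abs_le] at hl; rw [abs_lt] at hclose
    have hlS : 2 * (Ngrid x.length * (Gx hsf h2).R) ≤ l * (Ngrid x.length * (Gx hsf h2).R) :=
      mul_le_mul_of_nonneg_right hl2 (by linarith only [hS])
    linarith only [hl.1, hclose.1, hm₀R, hlS, hS]
  subst hl_eq
  rw [Int.cast_one, one_mul] at hl
  have hR0 : 0 ≤ (Gx hsf h2).R := by have := R_gt hsf h2; linarith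
  have hN21 : 21 ≤ Ngrid x.length := by
    have := Ngrid_ge x.length
    exact_mod_cast (show ((21 : ℕ) : ℝ) ≤ Ngrid x.length by push_cast; linarith)
  refine ⟨rdiv m₀ (Ngrid x.length), rdiv_mem hR0 hN21 hl, ?_⟩
  unfold post
  rw [hsel]
  simp

end Post
/-! ### Assembly -/

section Assembly

/-- **The base relation**: measured strings on which the post-processor outputs `⌊R⌋` or `⌈R⌉`
(self-delimited), for every admissible field. [cite: Jozsa2003, §10 Thm. 7] -/
def R₀ (x : List Bool) : Set (List Bool) :=
  {v | ∀ (K : Type) [Field K] [NumberField K], Squarefree (decodeNat x) → 2 ≤ decodeNat x → Module.finrank ℚ K = 2 →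
    (∃ α : K, α ^ 2 = (decodeNat x : K)) →
      ∃ m : ℕ, (m = ⌊NumberField.Units.regulator K⌋₊ ∨ m = ⌈NumberField.Units.regulator K⌉₊) ∧
        post x v = boolPair (encodeNat m) []}

/-- Kernel probabilities are monotone in the event. [folklore] -/
theorem kernelProb_mono {A : Language Bool} (F : QCircuitFamily cliffordT) (w : List Bool) {E E' : Set (List Bool)} (h : E ⊆ E') :
    F.kernelProb A w E ≤ F.kernelProb A w E' := by
  unfold QCircuitFamily.kernelProb
  refine ENNReal.toReal_mono (ne_top_of_le_ne_top ENNReal.one_ne_top ?_) ((F.kernel A w).toOuterMeasure_mono (Set.inter_subset_left.trans h))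
  rw [← ((F.kernel A w).toOuterMeasure_apply_eq_one_iff Set.univ).2 (Set.subset_univ _)]
  exact (F.kernel A w).toOuterMeasure_mono (Set.inter_subset_left.trans (Set.subset_univ _))

set_option maxHeartbeats 1000000 in
set_option linter.constructorNameAsVariable false in
/-- **The quantum core succeeds with probability `≥ 2/3` on every input** (the linter
`constructorNameAsVariable` is disabled on this declaration: it exhausts the recursion depth on the
success event's `Finset` over the `2^44`-unit read-out type). [cite: Jozsa2003, §10 Thm. 6, Thm. 7] -/
theorem kernelProb_R₀_ge (htab : CodeFP (pairE strE natE) strE fun p => tab p.1 p.2) (x : List Bool) :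
    2 / 3 ≤ (fam htab).kernelProb 0 x (R₀ x) := by
  by_cases hp : Squarefree (dOf x) ∧ 2 ≤ dOf x
  · obtain ⟨hsf, h2⟩ := hp
    let E : Finset (hallgrenSS.Readout x.length) := univ.filter fun γ => ∃ i : Fin NPAIRS, GoodPair hsf h2 i (γ (ua i)) (γ (ub i))
    have hk := hallgrenSS.kernelProb_family (blockFn_mem_FP htab) x E
    have hE := prob_exists_goodPair_ge hsf h2
    have hsub : {v : List Bool | hallgrenSS.readOf x.length v ∈ E} ⊆ R₀ x := by
      intro v hv K _ _ _ _ hK hα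
      simp only [Set.mem_setOf_eq, E, mem_filter, mem_univ, true_and] at hv
      obtain ⟨r, hr, hpost⟩ := post_correct hsf h2 hv
      obtain ⟨α, hα⟩ := hα
      refine ⟨r, ?_, hpost⟩
      rw [regulator_eq_R hsf h2 hK hα]; exact hr
    calc (2 : ℝ) / 3 ≤ 4 / 5 := by norm_num
      _ ≤ _ := hE
      _ = (fam htab).kernelProb 0 x {v : List Bool | hallgrenSS.readOf x.length v ∈ E} := hk.symm
      _ ≤ _ := kernelProb_mono _ _ hsub
  · -- off the promise the relation is everything
    have huniv : R₀ x = Set.univ := by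
      ext v
      simp only [R₀, Set.mem_setOf_eq, Set.mem_univ, iff_true]
      intro K _ _ hsf h2
      exact absurd ⟨hsf, h2⟩ hp
    have hk := hallgrenSS.kernelProb_family (blockFn_mem_FP htab) x univ
    rw [huniv]
    have hset : {v : List Bool | hallgrenSS.readOf x.length v ∈ (univ : Finset (hallgrenSS.Readout x.length))} = Set.univ := by
      ext v; simp
    rw [hset] at hk
    change (fam htab).kernelProb 0 x Set.univ = _ at hk
    rw [hk, prob_univ (unitLaw_isProbVec _ _)]; norm_num

/-- **The base relation is solvable in quantum polynomial time.** [cite: Jozsa2003, §10 Thm. 6] -/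
theorem isQSolvable_R₀ : IsQSolvable R₀ :=
  ⟨fam tab_str, hallgrenSS.family_isOracleFree _, hallgrenSS.family_isUniform (blockFn_mem_FP tab_str) hallgrenGE,
    kernelProb_R₀_ge tab_str⟩

/-- Appending to an empty second component (as `FregeTransl.boolPair_nil_append` of
`MetaComplexity/FregeTranslation.lean`, not imported — a private copy). [folklore] -/
private theorem boolPair_nil_append (a t : List Bool) : boolPair a [] ++ t = boolPair a t := by
  simp [boolPair]

end Assembly

end HallgrenQuantum

/-- **Hallgren's theorem, self-delimiting form** (Jozsa 2003, Thm. 7): the quantum core on the walk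
table of the input followed by the classical post-processing, wrapped by
`isQSolvable_classicalWrap_holds`. [cite: Jozsa2003, §10 Thm. 6, Thm. 7] [cite: Hallgren2007] -/
theorem Hallgren2007_regulator_qsolvable_delim_holds : Hallgren2007_regulator_qsolvable_delim := by
  obtain ⟨g, hg, hge⟩ := HallgrenQuantum.exists_post_fn
  have hid : (fun w : List Bool => w) ∈ Complexity.FP := Complexity.PolyTimeComputable.id _
  have h := isQSolvable_classicalWrap_holds (fun w => w) g hid hg HallgrenQuantum.isQSolvable_R₀
  refine h.mono fun x z hz => ?_
  obtain ⟨y, hy, hpre⟩ := hz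
  intro K _ _ hsf h2 hK hα
  obtain ⟨m, hm, hpost⟩ := hy K hsf h2 hK hα
  rw [hge, hpost] at hpre
  obtain ⟨t, rfl⟩ := hpre
  exact ⟨m, t, hm, by simp [Complexity.boolPair]⟩

end Literature.Computability.Cryptography

end
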